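import Mathlib
import HarnessLib
import HarnessLib.Audit
import Summits.SmoothPoincare4.Statement
import Summits.SmoothPoincare4.SmoothPoincare4.Theses.RootDecompAD
import Literature.Topology.FourManifolds.CappellShaneson
import Literature.Topology.FourManifolds.HomotopyS4CompactProofs
import Literature.Topology.FourManifolds.CappellShanesonGompfEquivalence
import Literature.Topology.FourManifolds.CappellShanesonGompfReduction
import Literature.Topology.FourManifolds.CappellShanesonTraceClasses
import Literature.Topology.FourManifolds.CappellShanesonTraceSymmetry
import Literature.Topology.FourManifolds.CappellShanesonThmBWindow
import Literature.Topology.FourManifolds.CappellShanesonIwakiWindow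
import Literature.Topology.FourManifolds.CappellShanesonClassGroupSeventyGompf
import Literature.Topology.FourManifolds.CappellShanesonClassGroupSeventythreeGompf
import Literature.Topology.FourManifolds.CappellShanesonClassGroupSeventyfiveGompf
import Literature.Topology.FourManifolds.CappellShanesonSeventysixGompf
import Literature.Topology.FourManifolds.CappellShanesonClassGroupSeventysevenGompf

/-!
# LINE «twist-index» for the crux `RootDecompAD.WindowOrbitStandard` (item stmt-SmoothPoincare4-32668)

Planner decomp-sp4-lens-5, generation 12 (lens «finite/base range + asymptotic regime + bridge»), species R
(recognition inside the Cappell–Shaneson stratum; no existence fact consumed).  Writer W1 form: the REGISTERED stubs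
`stub_*` are the only sorries; the composition `WindowOrbitStandard_of` is hypothesis-free, sorry-free and concludes
the route declaration `Summit.SmoothPoincare4.SmoothPoincare4.Theses.RootDecompAD.WindowOrbitStandard` BY NAME.

THE LEVER (new object).  `TwistStd N` — **S⁴-recognition descends along a one-torus-surgery presentation of
intersection number `N`.**  Data (`IsTwistPresentation N A H`): a primitive row `b` (the linear 2-torus
`T_b ⊂ T³`), a twist direction `c ∈ b^⊥`, `k ∈ ℤ`, the HOST `H = A·(1 + k·c·b)` (so `A = H ∘ τ^{-k}`, `τ` the Dehn twist
of `T³` along the tori parallel to `T_b` in direction `c`), an oriented basis `(v, u)` of the lattice `b^⊥ ∩ ℤ³` with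
`H v = a·v ± N·u` — the circles `S¹_v` and `H(S¹_v)` of `T_b` meet algebraically `N` times — and `(H − 1) v = ±c`
(Gompf's direction `φ(α) − α`).  `TwistStd N`: for every such pair, if both Cappell–Shaneson spheres of the host
`H` are `S⁴` then so are those of `A`.  `N = 1` is Gompf's Theorem 2.1 with Lemma 2.2 (arXiv:0908.1914 pp. 5–6: the
circles meet once, `X_ψ ≅ X_φ` for `ψ = δ^k ∘ φ`); its standard-form instance is the tree's named fact
`gompf2010_deltaMove`.  `N = 3, 5` are NEW statements (the registered load-bearing stubs): «Gompf's log-transform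
move survives when `α` and `φ(α)` meet three (five) times».

WHY IT BITES HERE.  The eighteen Gompf-ISOLATED window classes (census CS16 §3; the nine `GompfEquiv`-isolation
certificates of the tree bundle) admit NO index-1 presentation landing in the decided range — that is what
"isolated" means — but ELEVEN of them admit an index-3 and the class `75a` (and its dual) an index-5 presentation
whose host lands at a Kim–Yamada/Gompf-decided trace (tree: `Summits/SmoothPoincare4/GompfChains/
CappellShanesonTorusSurgeryTablePart3` rows `rowI3_*`/`indexI3_*`, `row_23_145_73`+`index_23_145_73`,
`row_101_163_75`+`index_101_163_75`; NEW here: the dual class `75a* = (120,163,−70)`, index 5, landing trace 0).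
Routing the remaining classes through the crux's OWN disjunct `Std Aᵀ` (six unimodular intertwiners
`X ∼ Yᵀ`) and the negative window traces through Kim–Yamada duality `A = (A*)*` (tree `csDual`), the crux
compresses to   `GompfLeaves ∧ InvSpheres ∧ SevenChains ∧ TwistStd 3 ∧ TwistStd 5  ⟹  WindowOrbitStandard`
(kernel-checked, sorry-free: the anonymous `example` of §7 (W1: binder form kept as an `example`, not a named theorem, so the registry sees exactly one proof-of-item); the class-level cover `WindowCover` of the five open positive
traces is PROVED in §2 from the tree's Latimer–MacDuffee covers, 176 representative cases, modulo the floor stub `SevenChains`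
= the landed tree theorem `Theorems/CappellShanesonSpecialChains.sevenChains_gompfEquiv_akbulutKirbyMatrix`, whose module is
unbuilt on the farm snapshot), and in fact to the STRONGER transposition form `Std A ∨ Std Aᵀ` for every window class
(`windowStdOrTranspose`): the dual disjunct of the crux is not used.

* §1 typed objects: `Std`, `IsTwistPresentation`, `TwistStd`, `GompfLeaves`, `InvSpheres`, the named classes, `WindowCover`;
* §2 the FIVE registered stubs (floor: `stub_gompfLeaves`, `stub_invSpheres`, `stub_sevenChains`; load-bearing NEW: `stub_twistThree`,
  `stub_twistFive`) and the PROVED cover `windowCover_of : SevenChains → WindowCover`;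
* §3 instrument lemmas (conjugacy / Gompf / transpose / dual / inverse transport of `Std`) — all PROVED;
* §4 the EIGHT presentation certificates (7 re-keyed from the tree tables + 1 new), each `decide`/`simp`-checked — PROVED;
* §5 routing of the 22 open (class, trace) cells — PROVED;
* §6 the composition `WindowOrbitStandard_of` — PROVED (sorries only inside `stub_*`).
-/

set_option linter.dupNamespace false
set_option linter.style.longLine false

noncomputable section

open scoped Manifold ContDiff MatrixGroups Matrix
open Set
open Literature.Topology.FourManifolds
open Matrix.SpecialLinearGroup (transpose)

namespace Summit.SmoothPoincare4.SmoothPoincare4.Cruxes.WindowOrbitStandard.TwistIndex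

/-! ## §1 Typed objects -/

/-- `Std A`: every compact smooth Cappell–Shaneson sphere of `A` (either framing) is diffeomorphic to `S⁴` — the recognition
clause of the route text, verbatim.  (Vacuous unless `det (A − 1) = ±1`.) -/
def Std (A : SL(3, ℤ)) : Prop :=
  ∀ (X : Type) [TopologicalSpace X] [T2Space X] [SecondCountableTopology X] [ChartedSpace (EuclideanSpace ℝ (Fin 4)) X]
    [IsManifold (𝓡 4) ∞ X] [CompactSpace X],
    IsCappellShanesonSphereOf A X → Nonempty (X ≃ₘ⟮𝓡 4, 𝓡 4⟯ (Metric.sphere (0 : EuclideanSpace ℝ (Fin 5)) 1))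

/-- **One-torus-surgery presentation of intersection number `N`** of `A` by the host `H` (see the module docstring):
`b ⊥ c`; `H = A (1 + k c b)`; `(v, u)` an oriented basis of `b^⊥ ∩ ℤ³` (unimodular completion `w`); `H v = a v + N' u` with
`|N'| = N`; `(H − 1) v = ±c`. -/
def IsTwistPresentation (N : ℕ) (A H : SL(3, ℤ)) : Prop :=
  ∃ (k : ℤ) (b c v u w : Fin 3 → ℤ) (a N' : ℤ),
    b ⬝ᵥ c = 0 ∧
    (H : Matrix (Fin 3) (Fin 3) ℤ) = (A : Matrix (Fin 3) (Fin 3) ℤ) * (1 + k • Matrix.vecMulVec c b) ∧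
    b ⬝ᵥ v = 0 ∧ b ⬝ᵥ u = 0 ∧
    ((Matrix.of ![v, u, w]).det = 1 ∨ (Matrix.of ![v, u, w]).det = -1) ∧
    (H : Matrix (Fin 3) (Fin 3) ℤ) *ᵥ v = a • v + N' • u ∧ (N' = N ∨ N' = -(N : ℤ)) ∧
    (((H : Matrix (Fin 3) (Fin 3) ℤ) - 1) *ᵥ v = c ∨ ((H : Matrix (Fin 3) (Fin 3) ℤ) - 1) *ᵥ v = -c)

/-- **`TwistStd N` — S⁴-recognition descends along index-`N` one-torus-surgery presentations.**  `N = 1`: Gompf 2010 Thm 2.1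
+ Lemma 2.2 (in print).  `N = 3`, `N = 5`: NEW (the load-bearing stubs of this line). -/
def TwistStd (N : ℕ) : Prop :=
  ∀ A H : SL(3, ℤ), IsTwistPresentation N A H → Std H → Std A

/-- The three topological leaves of the Gompf reduction (the tree's NAMED, unproved Literature facts). -/
def GompfLeaves : Prop :=
  gompf2010_deltaMove.{0} ∧ gompf2010_akbulutKirby_framings.{0, 0} ∧ akbulutKirby1979_sphere_four

/-- **Inverting the monodromy preserves the Cappell–Shaneson spheres** (Gompf 2010 §3, first paragraph: "inverting `A`
preserves `X^ε_φ` but flips the sign of `det (A − I)`"; the mapping torus of `φ⁻¹` is that of `φ` with the base circle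
reversed).  In print; not yet in the tree (whose invariance lemmas are conjugation and Gompf moves). -/
def InvSpheres : Prop :=
  ∀ (A : SL(3, ℤ)) (X : Type) [TopologicalSpace X] [ChartedSpace (EuclideanSpace ℝ (Fin 4)) X],
    IsCappellShanesonSphereOf A X → IsCappellShanesonSphereOf A⁻¹ X

/-! ### The named classes (Kim–Yamada standard matrices `X_{c,d,n}`; the eleven Gompf-isolated window classes of positive
trace, `X_{83,105,73} ∼ 73cᵀ`, and the three negative-trace bases of the index certificates) -/

theorem dvd70a : (141 : ℤ) ∣ (csPoly 70).eval 104 := by norm_num [eval_csPoly]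
theorem dvd70b : (155 : ℤ) ∣ (csPoly 70).eval 37 := by norm_num [eval_csPoly]
theorem dvd73a : (145 : ℤ) ∣ (csPoly 73).eval 23 := by norm_num [eval_csPoly]
theorem dvd73b : (171 : ℤ) ∣ (csPoly 73).eval 23 := by norm_num [eval_csPoly]
theorem dvd73c : (189 : ℤ) ∣ (csPoly 73).eval 41 := by norm_num [eval_csPoly]
theorem dvd83 : (105 : ℤ) ∣ (csPoly 73).eval 83 := by norm_num [eval_csPoly]
theorem dvd75a : (163 : ℤ) ∣ (csPoly 75).eval 101 := by norm_num [eval_csPoly]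
theorem dvd75b : (197 : ℤ) ∣ (csPoly 75).eval 31 := by norm_num [eval_csPoly]
theorem dvd76a : (153 : ℤ) ∣ (csPoly 76).eval 98 := by norm_num [eval_csPoly]
theorem dvd76b : (141 : ℤ) ∣ (csPoly 76).eval 116 := by norm_num [eval_csPoly]
theorem dvd77a : (253 : ℤ) ∣ (csPoly 77).eval 61 := by norm_num [eval_csPoly]
theorem dvd77b : (145 : ℤ) ∣ (csPoly 77).eval 34 := by norm_num [eval_csPoly]
theorem dvdB65 : (141 : ℤ) ∣ (csPoly (-65)).eval 116 := by norm_num [eval_csPoly]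
theorem dvdB68 : (145 : ℤ) ∣ (csPoly (-68)).eval 34 := by norm_num [eval_csPoly]
theorem dvdB70 : (163 : ℤ) ∣ (csPoly (-70)).eval 120 := by norm_num [eval_csPoly]

/-- `70a = X_{104,141,70}`. -/ def M70a : SL(3, ℤ) := standardCSMatrix 104 141 70 dvd70a
/-- `70b = X_{37,155,70}`. -/ def M70b : SL(3, ℤ) := standardCSMatrix 37 155 70 dvd70b
/-- `73a = X_{23,145,73}`. -/ def M73a : SL(3, ℤ) := standardCSMatrix 23 145 73 dvd73a
/-- `73b = X_{23,171,73}`. -/ def M73b : SL(3, ℤ) := standardCSMatrix 23 171 73 dvd73b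
/-- `73c = X_{41,189,73}`. -/ def M73c : SL(3, ℤ) := standardCSMatrix 41 189 73 dvd73c
/-- `X_{83,105,73} ∼ 73cᵀ` (one KY move from the decided trace `−32`). -/ def M83 : SL(3, ℤ) := standardCSMatrix 83 105 73 dvd83
/-- `75a = X_{101,163,75}`. -/ def M75a : SL(3, ℤ) := standardCSMatrix 101 163 75 dvd75a
/-- `75b = X_{31,197,75}`. -/ def M75b : SL(3, ℤ) := standardCSMatrix 31 197 75 dvd75b
/-- `76a = X_{98,153,76}`. -/ def M76a : SL(3, ℤ) := standardCSMatrix 98 153 76 dvd76a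
/-- `76b = X_{116,141,76}`. -/ def M76b : SL(3, ℤ) := standardCSMatrix 116 141 76 dvd76b
/-- `77a = X_{61,253,77}`. -/ def M77a : SL(3, ℤ) := standardCSMatrix 61 253 77 dvd77a
/-- `77b = X_{34,145,77}`. -/ def M77b : SL(3, ℤ) := standardCSMatrix 34 145 77 dvd77b
/-- `X_{116,141,−65} ∼G 76b`, `∼ 70a*`. -/ def B65 : SL(3, ℤ) := standardCSMatrix 116 141 (-65) dvdB65
/-- `X_{34,145,−68} ∼G 77b`, `∼ 73a*`. -/ def B68 : SL(3, ℤ) := standardCSMatrix 34 145 (-68) dvdB68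
/-- `X_{120,163,−70} ∼ 75a*` (NEW base). -/ def B70 : SL(3, ℤ) := standardCSMatrix 120 163 (-70) dvdB70

/-- **The finite cover of the open window traces** (TRUE; tree-unpacking, size L): at each of the five positive open traces every
`det (A − 1) = 1` class is Gompf equivalent to `A₀` or CONJUGATE (in `SL(3,ℤ)`) to one of the eleven named isolated classes —
Latimer–MacDuffee covers `isConj_standardCSMatrix_of_trace_eq_{seventy,…,seventyseven}` + the descents and special chains inside
`gompfConjectureForTrace_*_of_undecided` / `CappellShanesonSpecialChains`.  (The negative open traces follow by duality in §6.) -/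
def WindowCover : Prop :=
  ∀ A : SL(3, ℤ), ((A : Matrix (Fin 3) (Fin 3) ℤ) - 1).det = 1 →
    (Matrix.trace (A : Matrix (Fin 3) (Fin 3) ℤ) = 70 ∨ Matrix.trace (A : Matrix (Fin 3) (Fin 3) ℤ) = 73 ∨
      Matrix.trace (A : Matrix (Fin 3) (Fin 3) ℤ) = 75 ∨ Matrix.trace (A : Matrix (Fin 3) (Fin 3) ℤ) = 76 ∨
      Matrix.trace (A : Matrix (Fin 3) (Fin 3) ℤ) = 77) →
    GompfEquiv A akbulutKirbyMatrix ∨ IsConj A M70a ∨ IsConj A M70b ∨ IsConj A M73a ∨ IsConj A M73b ∨ IsConj A M73c ∨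
      IsConj A M75a ∨ IsConj A M75b ∨ IsConj A M76a ∨ IsConj A M76b ∨ IsConj A M77a ∨ IsConj A M77b

/-! ## §2 The five REGISTERED stubs (the only sorries of the file) and the PROVED cover `windowCover` -/

/-- STUB 1 (FLOOR: the tree's three named facts `gompf2010_deltaMove`, `gompf2010_akbulutKirby_framings`, `akbulutKirby1979_sphere_four`). -/
theorem stub_gompfLeaves : GompfLeaves := by
  sorry

/-- STUB 2 (FLOOR, in print: Gompf 2010 §3 ¶1; size M against the tree's `IsCappellShanesonSphereOf`). -/
theorem stub_invSpheres : InvSpheres := by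
  sorry

/-- STUB 3 (LOAD-BEARING, NEW/OPEN): Gompf's move at intersection number three. -/
theorem stub_twistThree : TwistStd 3 := by
  sorry

/-- STUB 4 (LOAD-BEARING, NEW/OPEN): Gompf's move at intersection number five (used only for `75a, 75b, 75a*, 75b*`). -/
theorem stub_twistFive : TwistStd 5 := by
  sorry

/-- The seven special-chain memberships `d ∣ f_n(c)`. -/
theorem dvdC_178_191_73 : (191 : ℤ) ∣ (csPoly 73).eval 178 := by norm_num [eval_csPoly]
theorem dvdC_44_147_76 : (147 : ℤ) ∣ (csPoly 76).eval 44 := by norm_num [eval_csPoly]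
theorem dvdC_65_147_76 : (147 : ℤ) ∣ (csPoly 76).eval 65 := by norm_num [eval_csPoly]
theorem dvdC_86_147_76 : (147 : ℤ) ∣ (csPoly 76).eval 86 := by norm_num [eval_csPoly]
theorem dvdC_128_147_76 : (147 : ℤ) ∣ (csPoly 76).eval 128 := by norm_num [eval_csPoly]
theorem dvdC_46_173_76 : (173 : ℤ) ∣ (csPoly 76).eval 46 := by norm_num [eval_csPoly]
theorem dvdC_92_149_77 : (149 : ℤ) ∣ (csPoly 77).eval 92 := by norm_num [eval_csPoly]

/-- `SevenChains` — VERBATIM the statement of the tree THEOREM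
`Summit.SmoothPoincare4.SmoothPoincare4.Theorems.CappellShanesonSpecialChains.sevenChains_gompfEquiv_akbulutKirbyMatrix`
(the seven special classes of Kim–Yamada/Iwaki at the traces 73, 76, 77 are Gompf equivalent to `A₀`, certified chains). It is a
FLOOR stub only because that `Theorems/` module is `stale:unbuilt` on the farm snapshot this file must elaborate against
(2026-08-30); closure is the one-liner `exact sevenChains_gompfEquiv_akbulutKirbyMatrix` under `import …Theorems.CappellShanesonSpecialChains`. -/
def SevenChains : Prop :=
  GompfEquiv (standardCSMatrix 178 191 73 dvdC_178_191_73) akbulutKirbyMatrix ∧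
  GompfEquiv (standardCSMatrix 44 147 76 dvdC_44_147_76) akbulutKirbyMatrix ∧
  GompfEquiv (standardCSMatrix 65 147 76 dvdC_65_147_76) akbulutKirbyMatrix ∧
  GompfEquiv (standardCSMatrix 86 147 76 dvdC_86_147_76) akbulutKirbyMatrix ∧
  GompfEquiv (standardCSMatrix 128 147 76 dvdC_128_147_76) akbulutKirbyMatrix ∧
  GompfEquiv (standardCSMatrix 46 173 76 dvdC_46_173_76) akbulutKirbyMatrix ∧
  GompfEquiv (standardCSMatrix 92 149 77 dvdC_92_149_77) akbulutKirbyMatrix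

/-- STUB 5 (FLOOR = a landed tree THEOREM, see `SevenChains`). -/
theorem stub_sevenChains : SevenChains := by
  sorry

/-- `WindowCover` is PROVED (modulo the FLOOR stub `stub_sevenChains` for the seven special chains): the 176 Latimer–MacDuffee representative cases of the tree's covers
`isConj_standardCSMatrix_of_trace_eq_{seventy,seventythree,seventyfive,seventysix,seventyseven}` — 11 isolated named classes
(output as the `IsConj` disjunct), 7 special chains (`Theorems/CappellShanesonSpecialChains`), 158 one-move descents to decided
traces exactly as in the tree's `gompfConjectureForTrace_*_of[_undecided]` (generated from those proofs by `g12/compute/cover/gen_cover.py`). -/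
theorem windowCover_of (hS : SevenChains) : WindowCover := by
  intro A hdet htr
  rcases htr with htr | htr | htr | htr | htr
  · -- trace 70: 44 Latimer–MacDuffee representatives (tree: `isConj_standardCSMatrix_of_trace_eq_seventy`)
    rcases isConj_standardCSMatrix_of_trace_eq_seventy A hdet htr with hc0 | hc1 | hc2 | hc3 | hc4 | hc5 | hc6 | hc7 | hc8 | hc9 | hc10 | hc11 | hc12 | hc13 | hc14 | hc15 | hc16 | hc17 | hc18 | hc19 | hc20 | hc21 | hc22 | hc23 | hc24 | hc25 | hc26 | hc27 | hc28 | hc29 | hc30 | hc31 | hc32 | hc33 | hc34 | hc35 | hc36 | hc37 | hc38 | hc39 | hc40 | hc41 | hc42 | hc43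
    · exact Or.inl <| (GompfEquiv.of_isConj hc0).trans (gompfEquiv_standardCSMatrix_one_one 68 (one_dvd _))
    · exact Or.inl <| (GompfEquiv.of_isConj hc1).trans
        (gompfEquiv_standardCSMatrix_akbulutKirbyMatrix_of_modEq
          (gompfConjectureForTrace_of_mem_Icc_neg_seven_twelve (by norm_num)) rep0_dvd_eval_csPoly_seventy
          (show (70 : ℤ) ≡ 1 [ZMOD 3] by decide))
    · exact Or.inl <| (GompfEquiv.of_isConj hc2).trans
        (gompfEquiv_standardCSMatrix_akbulutKirbyMatrix_of_modEq
          (gompfConjectureForTrace_of_mem_Icc_neg_seven_twelve (by norm_num)) rep1_dvd_eval_csPoly_seventy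
          (show (70 : ℤ) ≡ -2 [ZMOD 9] by decide))
    · exact Or.inl <| (GompfEquiv.of_isConj hc3).trans
        (gompfEquiv_standardCSMatrix_akbulutKirbyMatrix_of_modEq
          gompfConjectureForTrace_neg_eleven rep2_dvd_eval_csPoly_seventy
          (show (70 : ℤ) ≡ -11 [ZMOD 27] by decide))
    · exact Or.inl <| (GompfEquiv.of_isConj hc4).trans
        (gompfEquiv_standardCSMatrix_akbulutKirbyMatrix_of_modEq
          gompfConjectureForTrace_neg_eleven rep3_dvd_eval_csPoly_seventy
          (show (70 : ℤ) ≡ -11 [ZMOD 81] by decide))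
    · exact Or.inl <| (GompfEquiv.of_isConj hc5).trans Iwaki2025.gompfEquiv_akbulutKirbyMatrix_186_199_70
    · exact Or.inl <| (GompfEquiv.of_isConj hc6).trans
        (gompfEquiv_standardCSMatrix_akbulutKirbyMatrix_of_modEq
          (gompfConjectureForTrace_of_mem_Icc_neg_seven_twelve (by norm_num)) rep5_dvd_eval_csPoly_seventy
          (show (70 : ℤ) ≡ 2 [ZMOD 17] by decide))
    · exact Or.inl <| (GompfEquiv.of_isConj hc7).trans
        (gompfEquiv_standardCSMatrix_akbulutKirbyMatrix_of_modEq
          gompfConjectureForTrace_nineteen rep6_dvd_eval_csPoly_seventy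
          (show (70 : ℤ) ≡ 19 [ZMOD 51] by decide))
    · exact Or.inl <| (GompfEquiv.of_isConj hc8).trans
        (gompfEquiv_standardCSMatrix_akbulutKirbyMatrix_of_modEq
          (gompfConjectureForTrace_of_mem_Icc_neg_seven_twelve (by norm_num)) rep7_dvd_eval_csPoly_seventy
          (show (70 : ℤ) ≡ -3 [ZMOD 73] by decide))
    · exact Or.inl <| (GompfEquiv.of_isConj hc9).trans
        (gompfEquiv_standardCSMatrix_akbulutKirbyMatrix_of_modEq
          (gompfConjectureForTrace_of_mem_Icc_neg_seven_twelve (by norm_num)) rep8_dvd_eval_csPoly_seventy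
          (show (70 : ℤ) ≡ -1 [ZMOD 71] by decide))
    · exact Or.inl <| (GompfEquiv.of_isConj hc10).trans
        (gompfEquiv_standardCSMatrix_akbulutKirbyMatrix_of_modEq
          gompfConjectureForTrace_twentyone rep9_dvd_eval_csPoly_seventy
          (show (70 : ℤ) ≡ 21 [ZMOD 49] by decide))
    · exact Or.inl <| (GompfEquiv.of_isConj hc11).trans
        (gompfEquiv_standardCSMatrix_akbulutKirbyMatrix_of_modEq
          (gompfConjectureForTrace_of_mem_Icc_neg_seven_twelve (by norm_num)) rep10_dvd_eval_csPoly_seventy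
          (show (70 : ℤ) ≡ 11 [ZMOD 59] by decide))
    · exact Or.inl <| (GompfEquiv.of_isConj hc12).trans
        (gompfEquiv_standardCSMatrix_akbulutKirbyMatrix_of_modEq
          gompfConjectureForTrace_neg_fortyfive rep11_dvd_eval_csPoly_seventy
          (show (70 : ℤ) ≡ -45 [ZMOD 115] by decide))
    · exact Or.inl <| (GompfEquiv.of_isConj hc13).trans
        (gompfEquiv_standardCSMatrix_akbulutKirbyMatrix_of_modEq
          gompfConjectureForTrace_twentythree rep12_dvd_eval_csPoly_seventy
          (show (70 : ℤ) ≡ 23 [ZMOD 47] by decide))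
    · exact Or.inr (Or.inl hc14) -- (104, 141, 70) ISOLATED, named
    · exact Or.inl <| (GompfEquiv.of_isConj hc15).trans
        (gompfEquiv_standardCSMatrix_akbulutKirbyMatrix_of_modEq
          (gompfConjectureForTrace_of_mem_Icc_neg_seven_twelve (by norm_num)) rep14_dvd_eval_csPoly_seventy
          (show (70 : ℤ) ≡ 1 [ZMOD 23] by decide))
    · exact Or.inl <| (GompfEquiv.of_isConj hc16).trans
        (gompfEquiv_standardCSMatrix_akbulutKirbyMatrix_of_modEq
          (gompfConjectureForTrace_of_mem_Icc_neg_seven_twelve (by norm_num)) rep15_dvd_eval_csPoly_seventy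
          (show (70 : ℤ) ≡ 11 [ZMOD 59] by decide))
    · exact Or.inl <| (GompfEquiv.of_isConj hc17).trans
        (gompfEquiv_standardCSMatrix_akbulutKirbyMatrix_of_modEq
          (gompfConjectureForTrace_of_mem_Icc_neg_seven_twelve (by norm_num)) rep16_dvd_eval_csPoly_seventy
          (show (70 : ℤ) ≡ 11 [ZMOD 59] by decide))
    · exact Or.inl <| (GompfEquiv.of_isConj hc18).trans Iwaki2025.gompfEquiv_akbulutKirbyMatrix_47_151_70
    · exact Or.inl <| (GompfEquiv.of_isConj hc19).trans Iwaki2025.gompfEquiv_akbulutKirbyMatrix_96_203_70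
    · exact Or.inl <| (GompfEquiv.of_isConj hc20).trans
        (gompfEquiv_standardCSMatrix_akbulutKirbyMatrix_of_modEq
          (gompfConjectureForTrace_of_mem_Icc_neg_seven_twelve (by norm_num)) rep19_dvd_eval_csPoly_seventy
          (show (70 : ℤ) ≡ 4 [ZMOD 11] by decide))
    · exact Or.inl <| (GompfEquiv.of_isConj hc21).trans
        (gompfEquiv_standardCSMatrix_akbulutKirbyMatrix_of_modEq
          (gompfConjectureForTrace_of_mem_Icc_neg_seven_twelve (by norm_num)) rep20_dvd_eval_csPoly_seventy
          (show (70 : ℤ) ≡ 4 [ZMOD 33] by decide))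
    · exact Or.inl <| (GompfEquiv.of_isConj hc22).trans
        (gompfEquiv_standardCSMatrix_akbulutKirbyMatrix_of_modEq
          gompfConjectureForTrace_neg_sixteen rep21_dvd_eval_csPoly_seventy
          (show (70 : ℤ) ≡ -16 [ZMOD 43] by decide))
    · exact Or.inl <| (GompfEquiv.of_isConj hc23).trans
        (gompfEquiv_standardCSMatrix_akbulutKirbyMatrix_of_modEq
          gompfConjectureForTrace_neg_sixteen rep22_dvd_eval_csPoly_seventy
          (show (70 : ℤ) ≡ -16 [ZMOD 43] by decide))
    · exact Or.inl <| (GompfEquiv.of_isConj hc24).trans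
        (gompfEquiv_standardCSMatrix_akbulutKirbyMatrix_of_modEq
          (gompfConjectureForTrace_of_mem_Icc_neg_seven_twelve (by norm_num)) rep23_dvd_eval_csPoly_seventy
          (show (70 : ℤ) ≡ 0 [ZMOD 35] by decide))
    · exact Or.inl <| (GompfEquiv.of_isConj hc25).trans
        (gompfEquiv_standardCSMatrix_akbulutKirbyMatrix_of_modEq
          gompfConjectureForTrace_neg_thirtyfive rep24_dvd_eval_csPoly_seventy
          (show (70 : ℤ) ≡ -35 [ZMOD 105] by decide))
    · exact Or.inl <| (GompfEquiv.of_isConj hc26).trans Iwaki2025.gompfEquiv_akbulutKirbyMatrix_59_187_70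
    · exact Or.inl <| (GompfEquiv.of_isConj hc27).trans
        (gompfEquiv_standardCSMatrix_akbulutKirbyMatrix_of_modEq
          (gompfConjectureForTrace_of_mem_Icc_neg_seven_twelve (by norm_num)) rep26_dvd_eval_csPoly_seventy
          (show (70 : ℤ) ≡ 0 [ZMOD 7] by decide))
    · exact Or.inl <| (GompfEquiv.of_isConj hc28).trans
        (gompfEquiv_standardCSMatrix_akbulutKirbyMatrix_of_modEq
          (gompfConjectureForTrace_of_mem_Icc_neg_seven_twelve (by norm_num)) rep27_dvd_eval_csPoly_seventy
          (show (70 : ℤ) ≡ 7 [ZMOD 21] by decide))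
    · exact Or.inl <| (GompfEquiv.of_isConj hc29).trans
        (gompfEquiv_standardCSMatrix_akbulutKirbyMatrix_of_modEq
          (gompfConjectureForTrace_of_mem_Icc_neg_seven_twelve (by norm_num)) rep28_dvd_eval_csPoly_seventy
          (show (70 : ℤ) ≡ 7 [ZMOD 63] by decide))
    · exact Or.inr (Or.inr (Or.inl hc30)) -- (37, 155, 70) ISOLATED, named
    · exact Or.inl <| (GompfEquiv.of_isConj hc31).trans
        (gompfEquiv_standardCSMatrix_akbulutKirbyMatrix_of_modEq
          gompfConjectureForTrace_neg_twelve rep30_dvd_eval_csPoly_seventy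
          (show (70 : ℤ) ≡ -12 [ZMOD 41] by decide))
    · exact Or.inl <| (GompfEquiv.of_isConj hc32).trans
        (gompfEquiv_standardCSMatrix_akbulutKirbyMatrix_of_modEq
          gompfConjectureForTrace_twentythree rep31_dvd_eval_csPoly_seventy
          (show (70 : ℤ) ≡ 23 [ZMOD 47] by decide))
    · exact Or.inl <| (GompfEquiv.of_isConj hc33).trans
        (gompfEquiv_standardCSMatrix_akbulutKirbyMatrix_of_modEq
          (gompfConjectureForTrace_of_mem_Icc_neg_seven_twelve (by norm_num)) rep32_dvd_eval_csPoly_seventy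
          (show (70 : ℤ) ≡ 8 [ZMOD 31] by decide))
    · exact Or.inl <| (GompfEquiv.of_isConj hc34).trans
        (gompfEquiv_standardCSMatrix_akbulutKirbyMatrix_of_modEq
          gompfConjectureForTrace_neg_twentythree rep33_dvd_eval_csPoly_seventy
          (show (70 : ℤ) ≡ -23 [ZMOD 93] by decide))
    · exact Or.inl <| (GompfEquiv.of_isConj hc35).trans
        (gompfEquiv_standardCSMatrix_akbulutKirbyMatrix_of_modEq
          gompfConjectureForTrace_neg_fiftyfive rep34_dvd_eval_csPoly_seventy
          (show (70 : ℤ) ≡ -55 [ZMOD 125] by decide))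
    · exact Or.inl <| (GompfEquiv.of_isConj hc36).trans
        (gompfEquiv_standardCSMatrix_akbulutKirbyMatrix_of_modEq
          (gompfConjectureForTrace_of_mem_Icc_neg_seven_twelve (by norm_num)) rep35_dvd_eval_csPoly_seventy
          (show (70 : ℤ) ≡ 12 [ZMOD 29] by decide))
    · exact Or.inl <| (GompfEquiv.of_isConj hc37).trans
        (gompfEquiv_standardCSMatrix_akbulutKirbyMatrix_of_modEq
          (gompfConjectureForTrace_of_mem_Icc_neg_seven_twelve (by norm_num)) rep36_dvd_eval_csPoly_seventy
          (show (70 : ℤ) ≡ 3 [ZMOD 67] by decide))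
    · exact Or.inl <| (GompfEquiv.of_isConj hc38).trans
        (gompfEquiv_standardCSMatrix_akbulutKirbyMatrix_of_modEq
          (gompfConjectureForTrace_of_mem_Icc_neg_seven_twelve (by norm_num)) rep37_dvd_eval_csPoly_seventy
          (show (70 : ℤ) ≡ -5 [ZMOD 25] by decide))
    · exact Or.inl <| (GompfEquiv.of_isConj hc39).trans
        (gompfEquiv_standardCSMatrix_akbulutKirbyMatrix_of_modEq
          (gompfConjectureForTrace_of_mem_Icc_neg_seven_twelve (by norm_num)) rep38_dvd_eval_csPoly_seventy
          (show (70 : ℤ) ≡ -5 [ZMOD 75] by decide))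
    · exact Or.inl <| (GompfEquiv.of_isConj hc40).trans
        (gompfEquiv_standardCSMatrix_akbulutKirbyMatrix_of_modEq
          gompfConjectureForTrace_neg_fiftyone rep39_dvd_eval_csPoly_seventy
          (show (70 : ℤ) ≡ -51 [ZMOD 121] by decide))
    · exact Or.inl <| (GompfEquiv.of_isConj hc41).trans
        (gompfEquiv_standardCSMatrix_akbulutKirbyMatrix_of_modEq
          (gompfConjectureForTrace_of_mem_Icc_neg_seven_twelve (by norm_num)) rep40_dvd_eval_csPoly_seventy
          (show (70 : ℤ) ≡ 0 [ZMOD 5] by decide))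
    · exact Or.inl <| (GompfEquiv.of_isConj hc42).trans
        (gompfEquiv_standardCSMatrix_akbulutKirbyMatrix_of_modEq
          (gompfConjectureForTrace_of_mem_Icc_neg_seven_twelve (by norm_num)) rep41_dvd_eval_csPoly_seventy
          (show (70 : ℤ) ≡ -5 [ZMOD 15] by decide))
    · exact Or.inl <| (GompfEquiv.of_isConj hc43).trans
        (gompfEquiv_standardCSMatrix_akbulutKirbyMatrix_of_modEq
          gompfConjectureForTrace_neg_sixteen rep42_dvd_eval_csPoly_seventy
          (show (70 : ℤ) ≡ -16 [ZMOD 43] by decide))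
  · -- trace 73: 38 Latimer–MacDuffee representatives (tree: `isConj_standardCSMatrix_of_trace_eq_seventythree`)
    rcases isConj_standardCSMatrix_of_trace_eq_seventythree A hdet htr with hc0 | hc1 | hc2 | hc3 | hc4 | hc5 | hc6 | hc7 | hc8 | hc9 | hc10 | hc11 | hc12 | hc13 | hc14 | hc15 | hc16 | hc17 | hc18 | hc19 | hc20 | hc21 | hc22 | hc23 | hc24 | hc25 | hc26 | hc27 | hc28 | hc29 | hc30 | hc31 | hc32 | hc33 | hc34 | hc35 | hc36 | hc37
    · exact Or.inl <| (GompfEquiv.of_isConj hc0).trans (gompfEquiv_standardCSMatrix_one_one 71 (one_dvd _))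
    · exact Or.inl <| (GompfEquiv.of_isConj hc1).trans
        (gompfEquiv_standardCSMatrix_akbulutKirbyMatrix_of_modEq
          (gompfConjectureForTrace_of_mem_Icc_neg_seven_twelve (by norm_num)) rep0_dvd_eval_csPoly_seventythree
          (show (73 : ℤ) ≡ -5 [ZMOD 13] by decide))
    · exact Or.inl <| (GompfEquiv.of_isConj hc2).trans
        (gompfEquiv_standardCSMatrix_akbulutKirbyMatrix_of_modEq
          (gompfConjectureForTrace_of_mem_Icc_neg_seven_twelve (by norm_num)) rep1_dvd_eval_csPoly_seventythree
          (show (73 : ℤ) ≡ -2 [ZMOD 15] by decide))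
    · exact Or.inl <| (GompfEquiv.of_isConj hc3).trans
        (gompfEquiv_standardCSMatrix_akbulutKirbyMatrix_of_modEq
          gompfConjectureForTrace_neg_sixteen rep2_dvd_eval_csPoly_seventythree
          (show (73 : ℤ) ≡ -16 [ZMOD 89] by decide))
    · exact Or.inl ((GompfEquiv.of_isConj hc4).trans hS.1) -- special chain (tree theorem, via the FLOOR stub)
    · exact Or.inl <| (GompfEquiv.of_isConj hc5).trans
        (gompfEquiv_standardCSMatrix_akbulutKirbyMatrix_of_modEq
          gompfConjectureForTrace_twenty rep4_dvd_eval_csPoly_seventythree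
          (show (73 : ℤ) ≡ 20 [ZMOD 53] by decide))
    · exact Or.inl <| (GompfEquiv.of_isConj hc6).trans
        (gompfEquiv_standardCSMatrix_akbulutKirbyMatrix_of_modEq
          (gompfConjectureForTrace_of_mem_Icc_neg_seven_twelve (by norm_num)) rep5_dvd_eval_csPoly_seventythree
          (show (73 : ℤ) ≡ -2 [ZMOD 25] by decide))
    · exact Or.inl <| (GompfEquiv.of_isConj hc7).trans
        (gompfEquiv_standardCSMatrix_akbulutKirbyMatrix_of_modEq
          gompfConjectureForTrace_neg_thirteen rep6_dvd_eval_csPoly_seventythree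
          (show (73 : ℤ) ≡ -13 [ZMOD 43] by decide))
    · exact Or.inl <| (GompfEquiv.of_isConj hc8).trans
        (gompfEquiv_standardCSMatrix_akbulutKirbyMatrix_of_modEq
          (gompfConjectureForTrace_of_mem_Icc_neg_seven_twelve (by norm_num)) rep7_dvd_eval_csPoly_seventythree
          (show (73 : ℤ) ≡ 10 [ZMOD 63] by decide))
    · exact Or.inr (Or.inr (Or.inr (Or.inl hc9))) -- (23, 145, 73) ISOLATED, named
    · exact Or.inl <| (GompfEquiv.of_isConj hc10).trans
        (gompfEquiv_standardCSMatrix_akbulutKirbyMatrix_of_modEq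
          (gompfConjectureForTrace_of_mem_Icc_neg_seven_twelve (by norm_num)) rep9_dvd_eval_csPoly_seventythree
          (show (73 : ℤ) ≡ 3 [ZMOD 7] by decide))
    · exact Or.inl <| (GompfEquiv.of_isConj hc11).trans
        (gompfEquiv_standardCSMatrix_akbulutKirbyMatrix_of_modEq
          gompfConjectureForTrace_sixteen rep10_dvd_eval_csPoly_seventythree
          (show (73 : ℤ) ≡ 16 [ZMOD 57] by decide))
    · exact Or.inl <| (GompfEquiv.of_isConj hc12).trans
        (gompfEquiv_standardCSMatrix_akbulutKirbyMatrix_of_modEq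
          gompfConjectureForTrace_neg_thirtytwo rep11_dvd_eval_csPoly_seventythree
          (show (73 : ℤ) ≡ -32 [ZMOD 105] by decide))
    · exact Or.inl <| (GompfEquiv.of_isConj hc13).trans
        (gompfEquiv_standardCSMatrix_akbulutKirbyMatrix_of_modEq
          gompfConjectureForTrace_twentytwo rep12_dvd_eval_csPoly_seventythree
          (show (73 : ℤ) ≡ 22 [ZMOD 51] by decide))
    · exact Or.inl <| (GompfEquiv.of_isConj hc14).trans
        (gompfEquiv_standardCSMatrix_akbulutKirbyMatrix_of_modEq
          gompfConjectureForTrace_fourteen rep13_dvd_eval_csPoly_seventythree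
          (show (73 : ℤ) ≡ 14 [ZMOD 59] by decide))
    · exact Or.inl <| (GompfEquiv.of_isConj hc15).trans
        (gompfEquiv_standardCSMatrix_akbulutKirbyMatrix_of_modEq
          gompfConjectureForTrace_neg_twentytwo rep14_dvd_eval_csPoly_seventythree
          (show (73 : ℤ) ≡ -22 [ZMOD 95] by decide))
    · exact Or.inl <| (GompfEquiv.of_isConj hc16).trans
        (gompfEquiv_standardCSMatrix_akbulutKirbyMatrix_of_modEq
          gompfConjectureForTrace_nineteen rep15_dvd_eval_csPoly_seventythree
          (show (73 : ℤ) ≡ 19 [ZMOD 27] by decide))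
    · exact Or.inl <| (GompfEquiv.of_isConj hc17).trans
        (gompfEquiv_standardCSMatrix_akbulutKirbyMatrix_of_modEq
          gompfConjectureForTrace_neg_twelve rep16_dvd_eval_csPoly_seventythree
          (show (73 : ℤ) ≡ -12 [ZMOD 85] by decide))
    · exact Or.inl <| (GompfEquiv.of_isConj hc18).trans
        (gompfEquiv_standardCSMatrix_akbulutKirbyMatrix_of_modEq
          (gompfConjectureForTrace_of_mem_Icc_neg_seven_twelve (by norm_num)) rep17_dvd_eval_csPoly_seventythree
          (show (73 : ℤ) ≡ 1 [ZMOD 3] by decide))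
    · exact Or.inl <| (GompfEquiv.of_isConj hc19).trans
        (gompfEquiv_standardCSMatrix_akbulutKirbyMatrix_of_modEq
          (gompfConjectureForTrace_of_mem_Icc_neg_seven_twelve (by norm_num)) rep18_dvd_eval_csPoly_seventythree
          (show (73 : ℤ) ≡ -5 [ZMOD 39] by decide))
    · exact Or.inl <| (GompfEquiv.of_isConj hc20).trans
        (gompfEquiv_standardCSMatrix_akbulutKirbyMatrix_of_modEq
          gompfConjectureForTrace_neg_seventeen rep19_dvd_eval_csPoly_seventythree
          (show (73 : ℤ) ≡ -17 [ZMOD 45] by decide))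
    · exact Or.inl <| (GompfEquiv.of_isConj hc21).trans
        (gompfEquiv_standardCSMatrix_akbulutKirbyMatrix_of_modEq
          gompfConjectureForTrace_neg_twentyfour rep20_dvd_eval_csPoly_seventythree
          (show (73 : ℤ) ≡ -24 [ZMOD 97] by decide))
    · exact Or.inl <| (GompfEquiv.of_isConj hc22).trans
        (gompfEquiv_standardCSMatrix_akbulutKirbyMatrix_of_modEq
          (gompfConjectureForTrace_of_mem_Icc_neg_seven_twelve (by norm_num)) rep21_dvd_eval_csPoly_seventythree
          (show (73 : ℤ) ≡ -2 [ZMOD 5] by decide))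
    · exact Or.inl <| (GompfEquiv.of_isConj hc23).trans
        (gompfEquiv_standardCSMatrix_akbulutKirbyMatrix_of_modEq
          (gompfConjectureForTrace_of_mem_Icc_neg_seven_twelve (by norm_num)) rep22_dvd_eval_csPoly_seventythree
          (show (73 : ℤ) ≡ 8 [ZMOD 65] by decide))
    · exact Or.inl <| (GompfEquiv.of_isConj hc24).trans
        (gompfEquiv_standardCSMatrix_akbulutKirbyMatrix_of_modEq
          (gompfConjectureForTrace_of_mem_Icc_neg_seven_twelve (by norm_num)) rep23_dvd_eval_csPoly_seventythree
          (show (73 : ℤ) ≡ -2 [ZMOD 75] by decide))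
    · exact Or.inl <| (GompfEquiv.of_isConj hc25).trans
        (gompfEquiv_standardCSMatrix_akbulutKirbyMatrix_of_modEq
          gompfConjectureForTrace_neg_fourteen rep24_dvd_eval_csPoly_seventythree
          (show (73 : ℤ) ≡ -14 [ZMOD 29] by decide))
    · exact Or.inr (Or.inr (Or.inr (Or.inr (Or.inr (Or.inl hc26))))) -- (41, 189, 73) ISOLATED, named
    · exact Or.inl <| (GompfEquiv.of_isConj hc27).trans
        (gompfEquiv_standardCSMatrix_akbulutKirbyMatrix_of_modEq
          (gompfConjectureForTrace_of_mem_Icc_neg_seven_twelve (by norm_num)) rep26_dvd_eval_csPoly_seventythree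
          (show (73 : ℤ) ≡ 4 [ZMOD 23] by decide))
    · exact Or.inl <| (GompfEquiv.of_isConj hc28).trans
        (gompfEquiv_standardCSMatrix_akbulutKirbyMatrix_of_modEq
          (gompfConjectureForTrace_of_mem_Icc_neg_seven_twelve (by norm_num)) rep27_dvd_eval_csPoly_seventythree
          (show (73 : ℤ) ≡ 10 [ZMOD 21] by decide))
    · exact Or.inr (Or.inr (Or.inr (Or.inr (Or.inl hc29)))) -- (23, 171, 73) ISOLATED, named
    · exact Or.inl <| (GompfEquiv.of_isConj hc30).trans
        (gompfEquiv_standardCSMatrix_akbulutKirbyMatrix_of_modEq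
          gompfConjectureForTrace_neg_thirty rep29_dvd_eval_csPoly_seventythree
          (show (73 : ℤ) ≡ -30 [ZMOD 103] by decide))
    · exact Or.inl <| (GompfEquiv.of_isConj hc31).trans
        (gompfEquiv_standardCSMatrix_akbulutKirbyMatrix_of_modEq
          (gompfConjectureForTrace_of_mem_Icc_neg_seven_twelve (by norm_num)) rep30_dvd_eval_csPoly_seventythree
          (show (73 : ℤ) ≡ -3 [ZMOD 19] by decide))
    · exact Or.inl <| (GompfEquiv.of_isConj hc32).trans
        (gompfEquiv_standardCSMatrix_akbulutKirbyMatrix_of_modEq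
          (gompfConjectureForTrace_of_mem_Icc_neg_seven_twelve (by norm_num)) rep31_dvd_eval_csPoly_seventythree
          (show (73 : ℤ) ≡ 3 [ZMOD 35] by decide))
    · exact Or.inl <| (GompfEquiv.of_isConj hc33).trans
        (gompfEquiv_standardCSMatrix_akbulutKirbyMatrix_of_modEq
          (gompfConjectureForTrace_of_mem_Icc_neg_seven_twelve (by norm_num)) rep32_dvd_eval_csPoly_seventythree
          (show (73 : ℤ) ≡ 5 [ZMOD 17] by decide))
    · exact Or.inl <| (GompfEquiv.of_isConj hc34).trans
        (gompfEquiv_standardCSMatrix_akbulutKirbyMatrix_of_modEq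
          gompfConjectureForTrace_neg_eight rep33_dvd_eval_csPoly_seventythree
          (show (73 : ℤ) ≡ -8 [ZMOD 81] by decide))
    · exact Or.inl <| (GompfEquiv.of_isConj hc35).trans
        (gompfEquiv_standardCSMatrix_akbulutKirbyMatrix_of_modEq
          gompfConjectureForTrace_neg_forty rep34_dvd_eval_csPoly_seventythree
          (show (73 : ℤ) ≡ -40 [ZMOD 113] by decide))
    · exact Or.inl <| (GompfEquiv.of_isConj hc36).trans
        (gompfEquiv_standardCSMatrix_akbulutKirbyMatrix_of_modEq
          (gompfConjectureForTrace_of_mem_Icc_neg_seven_twelve (by norm_num)) rep35_dvd_eval_csPoly_seventythree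
          (show (73 : ℤ) ≡ 1 [ZMOD 9] by decide))
    · exact Or.inl <| (GompfEquiv.of_isConj hc37).trans
        (gompfEquiv_standardCSMatrix_akbulutKirbyMatrix_of_modEq
          (gompfConjectureForTrace_of_mem_Icc_neg_seven_twelve (by norm_num)) rep36_dvd_eval_csPoly_seventythree
          (show (73 : ℤ) ≡ 11 [ZMOD 31] by decide))
  · -- trace 75: 24 Latimer–MacDuffee representatives (tree: `isConj_standardCSMatrix_of_trace_eq_seventyfive`)
    rcases isConj_standardCSMatrix_of_trace_eq_seventyfive A hdet htr with hc0 | hc1 | hc2 | hc3 | hc4 | hc5 | hc6 | hc7 | hc8 | hc9 | hc10 | hc11 | hc12 | hc13 | hc14 | hc15 | hc16 | hc17 | hc18 | hc19 | hc20 | hc21 | hc22 | hc23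
    · exact Or.inl <| (GompfEquiv.of_isConj hc0).trans (gompfEquiv_standardCSMatrix_one_one 73 (one_dvd _))
    · exact Or.inl <| (GompfEquiv.of_isConj hc1).trans
        (gompfEquiv_standardCSMatrix_akbulutKirbyMatrix_of_modEq
          (gompfConjectureForTrace_of_mem_Icc_neg_seven_twelve (by norm_num)) rep0_dvd_eval_csPoly_seventyfive
          (show (75 : ℤ) ≡ -2 [ZMOD 7] by decide))
    · exact Or.inl <| (GompfEquiv.of_isConj hc2).trans
        (gompfEquiv_standardCSMatrix_akbulutKirbyMatrix_of_modEq
          gompfConjectureForTrace_twentysix rep1_dvd_eval_csPoly_seventyfive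
          (show (75 : ℤ) ≡ 26 [ZMOD 49] by decide))
    · exact Or.inl <| (GompfEquiv.of_isConj hc3).trans
        (gompfEquiv_standardCSMatrix_akbulutKirbyMatrix_of_modEq
          gompfConjectureForTrace_neg_twelve rep2_dvd_eval_csPoly_seventyfive
          (show (75 : ℤ) ≡ -12 [ZMOD 29] by decide))
    · exact Or.inl <| (GompfEquiv.of_isConj hc4).trans
        (gompfEquiv_standardCSMatrix_akbulutKirbyMatrix_of_modEq
          gompfConjectureForTrace_neg_fiftytwo rep3_dvd_eval_csPoly_seventyfive
          (show (75 : ℤ) ≡ -52 [ZMOD 127] by decide))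
    · exact Or.inl <| (GompfEquiv.of_isConj hc5).trans
        (gompfEquiv_standardCSMatrix_akbulutKirbyMatrix_of_modEq
          gompfConjectureForTrace_neg_eighteen rep4_dvd_eval_csPoly_seventyfive
          (show (75 : ℤ) ≡ -18 [ZMOD 31] by decide))
    · exact Or.inl <| (GompfEquiv.of_isConj hc6).trans
        (gompfEquiv_standardCSMatrix_akbulutKirbyMatrix_of_modEq
          (gompfConjectureForTrace_of_mem_Icc_neg_seven_twelve (by norm_num)) rep5_dvd_eval_csPoly_seventyfive
          (show (75 : ℤ) ≡ 0 [ZMOD 25] by decide))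
    · exact Or.inl <| (GompfEquiv.of_isConj hc7).trans
        (gompfEquiv_standardCSMatrix_akbulutKirbyMatrix_of_modEq
          gompfConjectureForTrace_neg_fiftytwo rep6_dvd_eval_csPoly_seventyfive
          (show (75 : ℤ) ≡ -52 [ZMOD 127] by decide))
    · exact Or.inl <| (GompfEquiv.of_isConj hc8).trans
        (gompfEquiv_standardCSMatrix_akbulutKirbyMatrix_of_modEq
          (gompfConjectureForTrace_of_mem_Icc_neg_seven_twelve (by norm_num)) rep7_dvd_eval_csPoly_seventyfive
          (show (75 : ℤ) ≡ -3 [ZMOD 13] by decide))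
    · exact Or.inl <| (GompfEquiv.of_isConj hc9).trans
        (gompfEquiv_standardCSMatrix_akbulutKirbyMatrix_of_modEq
          gompfConjectureForTrace_neg_twelve rep8_dvd_eval_csPoly_seventyfive
          (show (75 : ℤ) ≡ -12 [ZMOD 29] by decide))
    · exact Or.inr (Or.inr (Or.inr (Or.inr (Or.inr (Or.inr (Or.inl hc10)))))) -- (101, 163, 75) ISOLATED, named
    · exact Or.inl <| (GompfEquiv.of_isConj hc11).trans
        (gompfEquiv_standardCSMatrix_akbulutKirbyMatrix_of_modEq
          (gompfConjectureForTrace_of_mem_Icc_neg_seven_twelve (by norm_num)) rep10_dvd_eval_csPoly_seventyfive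
          (show (75 : ℤ) ≡ -7 [ZMOD 41] by decide))
    · exact Or.inl <| (GompfEquiv.of_isConj hc12).trans
        (gompfEquiv_standardCSMatrix_akbulutKirbyMatrix_of_modEq
          gompfConjectureForTrace_neg_twelve rep11_dvd_eval_csPoly_seventyfive
          (show (75 : ℤ) ≡ -12 [ZMOD 29] by decide))
    · exact Or.inl <| (GompfEquiv.of_isConj hc13).trans
        (gompfEquiv_standardCSMatrix_akbulutKirbyMatrix_of_modEq
          gompfConjectureForTrace_neg_fiftytwo rep12_dvd_eval_csPoly_seventyfive
          (show (75 : ℤ) ≡ -52 [ZMOD 127] by decide))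
    · exact Or.inr (Or.inr (Or.inr (Or.inr (Or.inr (Or.inr (Or.inr (Or.inl hc14))))))) -- (31, 197, 75) ISOLATED, named
    · exact Or.inl <| (GompfEquiv.of_isConj hc15).trans
        (gompfEquiv_standardCSMatrix_akbulutKirbyMatrix_of_modEq
          (gompfConjectureForTrace_of_mem_Icc_neg_seven_twelve (by norm_num)) rep14_dvd_eval_csPoly_seventyfive
          (show (75 : ℤ) ≡ 0 [ZMOD 5] by decide))
    · exact Or.inl <| (GompfEquiv.of_isConj hc16).trans
        (gompfEquiv_standardCSMatrix_akbulutKirbyMatrix_of_modEq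
          (gompfConjectureForTrace_of_mem_Icc_neg_seven_twelve (by norm_num)) rep15_dvd_eval_csPoly_seventyfive
          (show (75 : ℤ) ≡ 5 [ZMOD 35] by decide))
    · exact Or.inl <| (GompfEquiv.of_isConj hc17).trans
        (gompfEquiv_standardCSMatrix_akbulutKirbyMatrix_of_modEq
          gompfConjectureForTrace_neg_thirtytwo rep16_dvd_eval_csPoly_seventyfive
          (show (75 : ℤ) ≡ -32 [ZMOD 107] by decide))
    · exact Or.inl <| (GompfEquiv.of_isConj hc18).trans
        (gompfEquiv_standardCSMatrix_akbulutKirbyMatrix_of_modEq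
          (gompfConjectureForTrace_of_mem_Icc_neg_seven_twelve (by norm_num)) rep17_dvd_eval_csPoly_seventyfive
          (show (75 : ℤ) ≡ 1 [ZMOD 37] by decide))
    · exact Or.inl <| (GompfEquiv.of_isConj hc19).trans
        (gompfEquiv_standardCSMatrix_akbulutKirbyMatrix_of_modEq
          (gompfConjectureForTrace_of_mem_Icc_neg_seven_twelve (by norm_num)) rep18_dvd_eval_csPoly_seventyfive
          (show (75 : ℤ) ≡ 8 [ZMOD 67] by decide))
    · exact Or.inl <| (GompfEquiv.of_isConj hc20).trans
        (gompfEquiv_standardCSMatrix_akbulutKirbyMatrix_of_modEq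
          gompfConjectureForTrace_neg_thirtyeight rep19_dvd_eval_csPoly_seventyfive
          (show (75 : ℤ) ≡ -38 [ZMOD 113] by decide))
    · exact Or.inl <| (GompfEquiv.of_isConj hc21).trans
        (gompfEquiv_standardCSMatrix_akbulutKirbyMatrix_of_modEq
          gompfConjectureForTrace_neg_eighteen rep20_dvd_eval_csPoly_seventyfive
          (show (75 : ℤ) ≡ -18 [ZMOD 31] by decide))
    · exact Or.inl <| (GompfEquiv.of_isConj hc22).trans
        (gompfEquiv_standardCSMatrix_akbulutKirbyMatrix_of_modEq
          gompfConjectureForTrace_neg_eighteen rep21_dvd_eval_csPoly_seventyfive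
          (show (75 : ℤ) ≡ -18 [ZMOD 31] by decide))
    · exact Or.inl <| (GompfEquiv.of_isConj hc23).trans
        (gompfEquiv_standardCSMatrix_akbulutKirbyMatrix_of_modEq
          gompfConjectureForTrace_sixteen rep22_dvd_eval_csPoly_seventyfive
          (show (75 : ℤ) ≡ 16 [ZMOD 59] by decide))
  · -- trace 76: 35 Latimer–MacDuffee representatives (tree: `isConj_standardCSMatrix_of_trace_eq_seventysix`)
    rcases isConj_standardCSMatrix_of_trace_eq_seventysix A hdet htr with hc0 | hc1 | hc2 | hc3 | hc4 | hc5 | hc6 | hc7 | hc8 | hc9 | hc10 | hc11 | hc12 | hc13 | hc14 | hc15 | hc16 | hc17 | hc18 | hc19 | hc20 | hc21 | hc22 | hc23 | hc24 | hc25 | hc26 | hc27 | hc28 | hc29 | hc30 | hc31 | hc32 | hc33 | hc34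
    · exact Or.inl <| (GompfEquiv.of_isConj hc0).trans (gompfEquiv_standardCSMatrix_one_one 74 (one_dvd _))
    · exact Or.inl <| (GompfEquiv.of_isConj hc1).trans
        (gompfEquiv_standardCSMatrix_akbulutKirbyMatrix_of_modEq
          (gompfConjectureForTrace_of_mem_Icc_neg_sixtyfour_seventytwo (n := 1) (by norm_num) (by norm_num))
          rep1_dvd_eval_csPoly_seventysix (show (76 : ℤ) ≡ 1 [ZMOD 3] by decide))
    · exact Or.inl <| (GompfEquiv.of_isConj hc2).trans
        (gompfEquiv_standardCSMatrix_akbulutKirbyMatrix_of_modEq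
          (gompfConjectureForTrace_of_mem_Icc_neg_sixtyfour_seventytwo (n := -1) (by norm_num) (by norm_num))
          rep2_dvd_eval_csPoly_seventysix (show (76 : ℤ) ≡ -1 [ZMOD 7] by decide))
    · exact Or.inl <| (GompfEquiv.of_isConj hc3).trans
        (gompfEquiv_standardCSMatrix_akbulutKirbyMatrix_of_modEq
          (gompfConjectureForTrace_of_mem_Icc_neg_sixtyfour_seventytwo (n := 4) (by norm_num) (by norm_num))
          rep3_dvd_eval_csPoly_seventysix (show (76 : ℤ) ≡ 4 [ZMOD 9] by decide))
    · exact Or.inl <| (GompfEquiv.of_isConj hc4).trans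
        (gompfEquiv_standardCSMatrix_akbulutKirbyMatrix_of_modEq
          (gompfConjectureForTrace_of_mem_Icc_neg_sixtyfour_seventytwo (n := 8) (by norm_num) (by norm_num))
          rep4_dvd_eval_csPoly_seventysix (show (76 : ℤ) ≡ 8 [ZMOD 17] by decide))
    · exact Or.inl <| (GompfEquiv.of_isConj hc5).trans
        (gompfEquiv_standardCSMatrix_akbulutKirbyMatrix_of_modEq
          (gompfConjectureForTrace_of_mem_Icc_neg_sixtyfour_seventytwo (n := 8) (by norm_num) (by norm_num))
          rep5_dvd_eval_csPoly_seventysix (show (76 : ℤ) ≡ 8 [ZMOD 17] by decide))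
    · exact Or.inl <| (GompfEquiv.of_isConj hc6).trans
        (gompfEquiv_standardCSMatrix_akbulutKirbyMatrix_of_modEq
          (gompfConjectureForTrace_of_mem_Icc_neg_sixtyfour_seventytwo (n := 0) (by norm_num) (by norm_num))
          rep6_dvd_eval_csPoly_seventysix (show (76 : ℤ) ≡ 0 [ZMOD 19] by decide))
    · exact Or.inl <| (GompfEquiv.of_isConj hc7).trans
        (gompfEquiv_standardCSMatrix_akbulutKirbyMatrix_of_modEq
          (gompfConjectureForTrace_of_mem_Icc_neg_sixtyfour_seventytwo (n := -8) (by norm_num) (by norm_num))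
          rep7_dvd_eval_csPoly_seventysix (show (76 : ℤ) ≡ -8 [ZMOD 21] by decide))
    · exact Or.inl <| (GompfEquiv.of_isConj hc8).trans
        (gompfEquiv_standardCSMatrix_akbulutKirbyMatrix_of_modEq
          (gompfConjectureForTrace_of_mem_Icc_neg_sixtyfour_seventytwo (n := -5) (by norm_num) (by norm_num))
          rep8_dvd_eval_csPoly_seventysix (show (76 : ℤ) ≡ -5 [ZMOD 27] by decide))
    · exact Or.inl <| (GompfEquiv.of_isConj hc9).trans
        (gompfEquiv_standardCSMatrix_akbulutKirbyMatrix_of_modEq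
          (gompfConjectureForTrace_of_mem_Icc_neg_sixtyfour_seventytwo (n := 14) (by norm_num) (by norm_num))
          rep9_dvd_eval_csPoly_seventysix (show (76 : ℤ) ≡ 14 [ZMOD 31] by decide))
    · exact Or.inl <| (GompfEquiv.of_isConj hc10).trans
        (gompfEquiv_standardCSMatrix_akbulutKirbyMatrix_of_modEq
          (gompfConjectureForTrace_of_mem_Icc_neg_sixtyfour_seventytwo (n := 2) (by norm_num) (by norm_num))
          rep10_dvd_eval_csPoly_seventysix (show (76 : ℤ) ≡ 2 [ZMOD 37] by decide))
    · exact Or.inl <| (GompfEquiv.of_isConj hc11).trans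
        (gompfEquiv_standardCSMatrix_akbulutKirbyMatrix_of_modEq
          (gompfConjectureForTrace_of_mem_Icc_neg_sixtyfour_seventytwo (n := -6) (by norm_num) (by norm_num))
          rep11_dvd_eval_csPoly_seventysix (show (76 : ℤ) ≡ -6 [ZMOD 41] by decide))
    · exact Or.inl <| (GompfEquiv.of_isConj hc12).trans
        (gompfEquiv_standardCSMatrix_akbulutKirbyMatrix_of_modEq
          (gompfConjectureForTrace_of_mem_Icc_neg_sixtyfour_seventytwo (n := -10) (by norm_num) (by norm_num))
          rep12_dvd_eval_csPoly_seventysix (show (76 : ℤ) ≡ -10 [ZMOD 43] by decide))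
    · exact Or.inl <| (GompfEquiv.of_isConj hc13).trans
        (gompfEquiv_standardCSMatrix_akbulutKirbyMatrix_of_modEq
          (gompfConjectureForTrace_of_mem_Icc_neg_sixtyfour_seventytwo (n := -18) (by norm_num) (by norm_num))
          rep13_dvd_eval_csPoly_seventysix (show (76 : ℤ) ≡ -18 [ZMOD 47] by decide))
    · exact Or.inl <| (GompfEquiv.of_isConj hc14).trans
        (gompfEquiv_standardCSMatrix_akbulutKirbyMatrix_of_modEq
          (gompfConjectureForTrace_of_mem_Icc_neg_sixtyfour_seventytwo (n := -18) (by norm_num) (by norm_num))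
          rep14_dvd_eval_csPoly_seventysix (show (76 : ℤ) ≡ -18 [ZMOD 47] by decide))
    · exact Or.inl <| (GompfEquiv.of_isConj hc15).trans
        (gompfEquiv_standardCSMatrix_akbulutKirbyMatrix_of_modEq
          (gompfConjectureForTrace_of_mem_Icc_neg_sixtyfour_seventytwo (n := -18) (by norm_num) (by norm_num))
          rep15_dvd_eval_csPoly_seventysix (show (76 : ℤ) ≡ -18 [ZMOD 47] by decide))
    · exact Or.inl <| (GompfEquiv.of_isConj hc16).trans
        (gompfEquiv_standardCSMatrix_akbulutKirbyMatrix_of_modEq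
          (gompfConjectureForTrace_of_mem_Icc_neg_sixtyfour_seventytwo (n := -22) (by norm_num) (by norm_num))
          rep16_dvd_eval_csPoly_seventysix (show (76 : ℤ) ≡ -22 [ZMOD 49] by decide))
    · exact Or.inl <| (GompfEquiv.of_isConj hc17).trans
        (gompfEquiv_standardCSMatrix_akbulutKirbyMatrix_of_modEq
          (gompfConjectureForTrace_of_mem_Icc_neg_sixtyfour_seventytwo (n := -22) (by norm_num) (by norm_num))
          rep17_dvd_eval_csPoly_seventysix (show (76 : ℤ) ≡ -22 [ZMOD 49] by decide))
    · exact Or.inl <| (GompfEquiv.of_isConj hc18).trans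
        (gompfEquiv_standardCSMatrix_akbulutKirbyMatrix_of_modEq
          (gompfConjectureForTrace_of_mem_Icc_neg_sixtyfour_seventytwo (n := -22) (by norm_num) (by norm_num))
          rep18_dvd_eval_csPoly_seventysix (show (76 : ℤ) ≡ -22 [ZMOD 49] by decide))
    · exact Or.inl <| (GompfEquiv.of_isConj hc19).trans
        (gompfEquiv_standardCSMatrix_akbulutKirbyMatrix_of_modEq
          (gompfConjectureForTrace_of_mem_Icc_neg_sixtyfour_seventytwo (n := -22) (by norm_num) (by norm_num))
          rep19_dvd_eval_csPoly_seventysix (show (76 : ℤ) ≡ -22 [ZMOD 49] by decide))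
    · exact Or.inl <| (GompfEquiv.of_isConj hc20).trans
        (gompfEquiv_standardCSMatrix_akbulutKirbyMatrix_of_modEq
          (gompfConjectureForTrace_of_mem_Icc_neg_sixtyfour_seventytwo (n := -22) (by norm_num) (by norm_num))
          rep20_dvd_eval_csPoly_seventysix (show (76 : ℤ) ≡ -22 [ZMOD 49] by decide))
    · exact Or.inl <| (GompfEquiv.of_isConj hc21).trans
        (gompfEquiv_standardCSMatrix_akbulutKirbyMatrix_of_modEq
          (gompfConjectureForTrace_of_mem_Icc_neg_sixtyfour_seventytwo (n := -22) (by norm_num) (by norm_num))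
          rep21_dvd_eval_csPoly_seventysix (show (76 : ℤ) ≡ -22 [ZMOD 49] by decide))
    · exact Or.inl <| (GompfEquiv.of_isConj hc22).trans
        (gompfEquiv_standardCSMatrix_akbulutKirbyMatrix_of_modEq
          (gompfConjectureForTrace_of_mem_Icc_neg_sixtyfour_seventytwo (n := 25) (by norm_num) (by norm_num))
          rep22_dvd_eval_csPoly_seventysix (show (76 : ℤ) ≡ 25 [ZMOD 51] by decide))
    · exact Or.inl <| (GompfEquiv.of_isConj hc23).trans
        (gompfEquiv_standardCSMatrix_akbulutKirbyMatrix_of_modEq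
          (gompfConjectureForTrace_of_mem_Icc_neg_sixtyfour_seventytwo (n := 19) (by norm_num) (by norm_num))
          rep23_dvd_eval_csPoly_seventysix (show (76 : ℤ) ≡ 19 [ZMOD 57] by decide))
    · exact Or.inl <| (GompfEquiv.of_isConj hc24).trans
        (gompfEquiv_standardCSMatrix_akbulutKirbyMatrix_of_modEq
          (gompfConjectureForTrace_of_mem_Icc_neg_sixtyfour_seventytwo (n := 17) (by norm_num) (by norm_num))
          rep24_dvd_eval_csPoly_seventysix (show (76 : ℤ) ≡ 17 [ZMOD 59] by decide))
    · exact Or.inl <| (GompfEquiv.of_isConj hc25).trans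
        (gompfEquiv_standardCSMatrix_akbulutKirbyMatrix_of_modEq
          (gompfConjectureForTrace_of_mem_Icc_neg_sixtyfour_seventytwo (n := 13) (by norm_num) (by norm_num))
          rep25_dvd_eval_csPoly_seventysix (show (76 : ℤ) ≡ 13 [ZMOD 63] by decide))
    · exact Or.inl <| (GompfEquiv.of_isConj hc26).trans
        (gompfEquiv_standardCSMatrix_akbulutKirbyMatrix_of_modEq
          (gompfConjectureForTrace_of_mem_Icc_neg_sixtyfour_seventytwo (n := -53) (by norm_num) (by norm_num))
          rep26_dvd_eval_csPoly_seventysix (show (76 : ℤ) ≡ -53 [ZMOD 129] by decide))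
    · exact Or.inl <| (GompfEquiv.of_isConj hc27).trans
        (gompfEquiv_standardCSMatrix_akbulutKirbyMatrix_of_modEq
          (gompfConjectureForTrace_of_mem_Icc_neg_sixtyfour_seventytwo (n := -61) (by norm_num) (by norm_num))
          rep27_dvd_eval_csPoly_seventysix (show (76 : ℤ) ≡ -61 [ZMOD 137] by decide))
    · exact Or.inr (Or.inr (Or.inr (Or.inr (Or.inr (Or.inr (Or.inr (Or.inr (Or.inr (Or.inl hc28))))))))) -- (116, 141, 76) ISOLATED, named
    · exact Or.inl ((GompfEquiv.of_isConj hc29).trans hS.2.1) -- special chain (tree theorem, via the FLOOR stub)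
    · exact Or.inl ((GompfEquiv.of_isConj hc30).trans hS.2.2.1) -- special chain (tree theorem, via the FLOOR stub)
    · exact Or.inl ((GompfEquiv.of_isConj hc31).trans hS.2.2.2.1) -- special chain (tree theorem, via the FLOOR stub)
    · exact Or.inl ((GompfEquiv.of_isConj hc32).trans hS.2.2.2.2.1) -- special chain (tree theorem, via the FLOOR stub)
    · exact Or.inr (Or.inr (Or.inr (Or.inr (Or.inr (Or.inr (Or.inr (Or.inr (Or.inl hc33)))))))) -- (98, 153, 76) ISOLATED, named
    · exact Or.inl ((GompfEquiv.of_isConj hc34).trans hS.2.2.2.2.2.1) -- special chain (tree theorem, via the FLOOR stub)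
  · -- trace 77: 35 Latimer–MacDuffee representatives (tree: `isConj_standardCSMatrix_of_trace_eq_seventyseven`)
    rcases isConj_standardCSMatrix_of_trace_eq_seventyseven A hdet htr with hc0 | hc1 | hc2 | hc3 | hc4 | hc5 | hc6 | hc7 | hc8 | hc9 | hc10 | hc11 | hc12 | hc13 | hc14 | hc15 | hc16 | hc17 | hc18 | hc19 | hc20 | hc21 | hc22 | hc23 | hc24 | hc25 | hc26 | hc27 | hc28 | hc29 | hc30 | hc31 | hc32 | hc33 | hc34
    · exact Or.inl <| (GompfEquiv.of_isConj hc0).trans (gompfEquiv_standardCSMatrix_one_one 75 (one_dvd _))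
    · exact Or.inl <| (GompfEquiv.of_isConj hc1).trans
        (gompfEquiv_standardCSMatrix_akbulutKirbyMatrix_of_modEq
          (gompfConjectureForTrace_of_mem_Icc_neg_seven_twelve (by norm_num)) rep0_dvd_eval_csPoly_seventyseven
          (show (77 : ℤ) ≡ 2 [ZMOD 5] by decide))
    · exact Or.inl <| (GompfEquiv.of_isConj hc2).trans
        (gompfEquiv_standardCSMatrix_akbulutKirbyMatrix_of_modEq
          (gompfConjectureForTrace_of_mem_Icc_neg_seven_twelve (by norm_num)) rep1_dvd_eval_csPoly_seventyseven
          (show (77 : ℤ) ≡ 2 [ZMOD 25] by decide))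
    · exact Or.inl <| (GompfEquiv.of_isConj hc3).trans
        (gompfEquiv_standardCSMatrix_akbulutKirbyMatrix_of_modEq
          gompfConjectureForTrace_neg_twenty rep2_dvd_eval_csPoly_seventyseven
          (show (77 : ℤ) ≡ -20 [ZMOD 97] by decide))
    · exact Or.inl <| (GompfEquiv.of_isConj hc4).trans
        (gompfEquiv_standardCSMatrix_akbulutKirbyMatrix_of_modEq
          (gompfConjectureForTrace_of_mem_Icc_neg_seven_twelve (by norm_num)) rep3_dvd_eval_csPoly_seventyseven
          (show (77 : ℤ) ≡ 6 [ZMOD 71] by decide))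
    · exact Or.inl <| (GompfEquiv.of_isConj hc5).trans
        (gompfEquiv_standardCSMatrix_akbulutKirbyMatrix_of_modEq
          (gompfConjectureForTrace_of_mem_Icc_neg_seven_twelve (by norm_num)) rep4_dvd_eval_csPoly_seventyseven
          (show (77 : ℤ) ≡ 3 [ZMOD 37] by decide))
    · exact Or.inl <| (GompfEquiv.of_isConj hc6).trans
        (gompfEquiv_standardCSMatrix_akbulutKirbyMatrix_of_modEq
          gompfConjectureForTrace_neg_fourteen rep5_dvd_eval_csPoly_seventyseven
          (show (77 : ℤ) ≡ -14 [ZMOD 91] by decide))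
    · exact Or.inl <| (GompfEquiv.of_isConj hc7).trans
        (gompfEquiv_standardCSMatrix_akbulutKirbyMatrix_of_modEq
          gompfConjectureForTrace_neg_thirtysix rep6_dvd_eval_csPoly_seventyseven
          (show (77 : ℤ) ≡ -36 [ZMOD 113] by decide))
    · exact Or.inl <| (GompfEquiv.of_isConj hc8).trans
        (gompfEquiv_standardCSMatrix_akbulutKirbyMatrix_of_modEq
          (gompfConjectureForTrace_of_mem_Icc_neg_seven_twelve (by norm_num)) rep7_dvd_eval_csPoly_seventyseven
          (show (77 : ℤ) ≡ -1 [ZMOD 13] by decide))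
    · exact Or.inl <| (GompfEquiv.of_isConj hc9).trans
        (gompfEquiv_standardCSMatrix_akbulutKirbyMatrix_of_modEq
          (gompfConjectureForTrace_of_mem_Icc_neg_seven_twelve (by norm_num)) rep8_dvd_eval_csPoly_seventyseven
          (show (77 : ℤ) ≡ 12 [ZMOD 65] by decide))
    · exact Or.inl <| (GompfEquiv.of_isConj hc10).trans
        (gompfEquiv_standardCSMatrix_akbulutKirbyMatrix_of_modEq
          (gompfConjectureForTrace_of_mem_Icc_neg_seven_twelve (by norm_num)) rep9_dvd_eval_csPoly_seventyseven
          (show (77 : ℤ) ≡ -1 [ZMOD 13] by decide))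
    · exact Or.inl <| (GompfEquiv.of_isConj hc11).trans
        (gompfEquiv_standardCSMatrix_akbulutKirbyMatrix_of_modEq
          gompfConjectureForTrace_sixteen rep10_dvd_eval_csPoly_seventyseven
          (show (77 : ℤ) ≡ 16 [ZMOD 61] by decide))
    · exact Or.inr (Or.inr (Or.inr (Or.inr (Or.inr (Or.inr (Or.inr (Or.inr (Or.inr (Or.inr (Or.inl hc12)))))))))) -- (61, 253, 77) ISOLATED, named
    · exact Or.inl <| (GompfEquiv.of_isConj hc13).trans
        (gompfEquiv_standardCSMatrix_akbulutKirbyMatrix_of_modEq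
          gompfConjectureForTrace_neg_twentyone rep12_dvd_eval_csPoly_seventyseven
          (show (77 : ℤ) ≡ -21 [ZMOD 49] by decide))
    · exact Or.inl ((GompfEquiv.of_isConj hc14).trans hS.2.2.2.2.2.2) -- special chain (tree theorem, via the FLOOR stub)
    · exact Or.inl <| (GompfEquiv.of_isConj hc15).trans
        (gompfEquiv_standardCSMatrix_akbulutKirbyMatrix_of_modEq
          (gompfConjectureForTrace_of_mem_Icc_neg_seven_twelve (by norm_num)) rep14_dvd_eval_csPoly_seventyseven
          (show (77 : ℤ) ≡ -5 [ZMOD 41] by decide))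
    · exact Or.inl <| (GompfEquiv.of_isConj hc16).trans
        (gompfEquiv_standardCSMatrix_akbulutKirbyMatrix_of_modEq
          (gompfConjectureForTrace_of_mem_Icc_neg_seven_twelve (by norm_num)) rep15_dvd_eval_csPoly_seventyseven
          (show (77 : ℤ) ≡ 0 [ZMOD 77] by decide))
    · exact Or.inl <| (GompfEquiv.of_isConj hc17).trans
        (gompfEquiv_standardCSMatrix_akbulutKirbyMatrix_of_modEq
          (gompfConjectureForTrace_of_mem_Icc_neg_seven_twelve (by norm_num)) rep16_dvd_eval_csPoly_seventyseven
          (show (77 : ℤ) ≡ -1 [ZMOD 13] by decide))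
    · exact Or.inl <| (GompfEquiv.of_isConj hc18).trans
        (gompfEquiv_standardCSMatrix_akbulutKirbyMatrix_of_modEq
          (gompfConjectureForTrace_of_mem_Icc_neg_seven_twelve (by norm_num)) rep17_dvd_eval_csPoly_seventyseven
          (show (77 : ℤ) ≡ 12 [ZMOD 65] by decide))
    · exact Or.inl <| (GompfEquiv.of_isConj hc19).trans
        (gompfEquiv_standardCSMatrix_akbulutKirbyMatrix_of_modEq
          gompfConjectureForTrace_neg_twenty rep18_dvd_eval_csPoly_seventyseven
          (show (77 : ℤ) ≡ -20 [ZMOD 97] by decide))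
    · exact Or.inl <| (GompfEquiv.of_isConj hc20).trans
        (gompfEquiv_standardCSMatrix_akbulutKirbyMatrix_of_modEq
          (gompfConjectureForTrace_of_mem_Icc_neg_seven_twelve (by norm_num)) rep19_dvd_eval_csPoly_seventyseven
          (show (77 : ℤ) ≡ 8 [ZMOD 23] by decide))
    · exact Or.inl <| (GompfEquiv.of_isConj hc21).trans
        (gompfEquiv_standardCSMatrix_akbulutKirbyMatrix_of_modEq
          gompfConjectureForTrace_neg_thirtyeight rep20_dvd_eval_csPoly_seventyseven
          (show (77 : ℤ) ≡ -38 [ZMOD 115] by decide))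
    · exact Or.inl <| (GompfEquiv.of_isConj hc22).trans
        (gompfEquiv_standardCSMatrix_akbulutKirbyMatrix_of_modEq
          gompfConjectureForTrace_neg_ten rep21_dvd_eval_csPoly_seventyseven
          (show (77 : ℤ) ≡ -10 [ZMOD 29] by decide))
    · exact Or.inr (Or.inr (Or.inr (Or.inr (Or.inr (Or.inr (Or.inr (Or.inr (Or.inr (Or.inr (Or.inr (hc23))))))))))) -- (34, 145, 77) ISOLATED, named
    · exact Or.inl <| (GompfEquiv.of_isConj hc24).trans
        (gompfEquiv_standardCSMatrix_akbulutKirbyMatrix_of_modEq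
          (gompfConjectureForTrace_of_mem_Icc_neg_seven_twelve (by norm_num)) rep23_dvd_eval_csPoly_seventyseven
          (show (77 : ℤ) ≡ 0 [ZMOD 7] by decide))
    · exact Or.inl <| (GompfEquiv.of_isConj hc25).trans
        (gompfEquiv_standardCSMatrix_akbulutKirbyMatrix_of_modEq
          (gompfConjectureForTrace_of_mem_Icc_neg_seven_twelve (by norm_num)) rep24_dvd_eval_csPoly_seventyseven
          (show (77 : ℤ) ≡ 7 [ZMOD 35] by decide))
    · exact Or.inl <| (GompfEquiv.of_isConj hc26).trans
        (gompfEquiv_standardCSMatrix_akbulutKirbyMatrix_of_modEq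
          gompfConjectureForTrace_twentyfour rep25_dvd_eval_csPoly_seventyseven
          (show (77 : ℤ) ≡ 24 [ZMOD 53] by decide))
    · exact Or.inl <| (GompfEquiv.of_isConj hc27).trans
        (gompfEquiv_standardCSMatrix_akbulutKirbyMatrix_of_modEq
          (gompfConjectureForTrace_of_mem_Icc_neg_seven_twelve (by norm_num)) rep26_dvd_eval_csPoly_seventyseven
          (show (77 : ℤ) ≡ 0 [ZMOD 11] by decide))
    · exact Or.inl <| (GompfEquiv.of_isConj hc28).trans
        (gompfEquiv_standardCSMatrix_akbulutKirbyMatrix_of_modEq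
          gompfConjectureForTrace_twentytwo rep27_dvd_eval_csPoly_seventyseven
          (show (77 : ℤ) ≡ 22 [ZMOD 55] by decide))
    · exact Or.inl <| (GompfEquiv.of_isConj hc29).trans
        (gompfEquiv_standardCSMatrix_akbulutKirbyMatrix_of_modEq
          gompfConjectureForTrace_sixteen rep28_dvd_eval_csPoly_seventyseven
          (show (77 : ℤ) ≡ 16 [ZMOD 61] by decide))
    · exact Or.inl <| (GompfEquiv.of_isConj hc30).trans
        (gompfEquiv_standardCSMatrix_akbulutKirbyMatrix_of_modEq
          gompfConjectureForTrace_sixteen rep29_dvd_eval_csPoly_seventyseven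
          (show (77 : ℤ) ≡ 16 [ZMOD 61] by decide))
    · exact Or.inl <| (GompfEquiv.of_isConj hc31).trans
        (gompfEquiv_standardCSMatrix_akbulutKirbyMatrix_of_modEq
          gompfConjectureForTrace_neg_fifty rep30_dvd_eval_csPoly_seventyseven
          (show (77 : ℤ) ≡ -50 [ZMOD 127] by decide))
    · exact Or.inl <| (GompfEquiv.of_isConj hc32).trans
        (gompfEquiv_standardCSMatrix_akbulutKirbyMatrix_of_modEq
          gompfConjectureForTrace_neg_fourteen rep31_dvd_eval_csPoly_seventyseven
          (show (77 : ℤ) ≡ -14 [ZMOD 91] by decide))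
    · exact Or.inl <| (GompfEquiv.of_isConj hc33).trans
        (gompfEquiv_standardCSMatrix_akbulutKirbyMatrix_of_modEq
          (gompfConjectureForTrace_of_mem_Icc_neg_seven_twelve (by norm_num)) rep32_dvd_eval_csPoly_seventyseven
          (show (77 : ℤ) ≡ 9 [ZMOD 17] by decide))
    · exact Or.inl <| (GompfEquiv.of_isConj hc34).trans
        (gompfEquiv_standardCSMatrix_akbulutKirbyMatrix_of_modEq
          gompfConjectureForTrace_fifteen rep33_dvd_eval_csPoly_seventyseven
          (show (77 : ℤ) ≡ 15 [ZMOD 31] by decide))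

/-- The cover, from the FLOOR stub. -/
theorem windowCover : WindowCover := windowCover_of stub_sevenChains

/-! ## §3 Instrument lemmas: transport of `Std` (all PROVED) -/

/-- `Std` is a class function for conjugacy in `SL(3,ℤ)` (tree: `IsCappellShanesonSphereOf.of_isConj`). -/
theorem std_congr_isConj {A B : SL(3, ℤ)} (h : IsConj A B) : Std A ↔ Std B :=
  ⟨fun hs X _ _ _ _ _ _ hX => hs X (hX.of_isConj h.symm), fun hs X _ _ _ _ _ _ hX => hs X (hX.of_isConj h)⟩

/-- `Std` is constant on Gompf equivalence classes, granted the Δ-move leaf. -/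
theorem std_congr_gompfEquiv (hΔ : gompf2010_deltaMove.{0}) {A B : SL(3, ℤ)} (h : GompfEquiv A B) : Std A ↔ Std B :=
  ⟨fun hs X _ _ _ _ _ _ hX => hs X ((h.isCappellShanesonSphereOf_iff X hΔ).2 hX),
    fun hs X _ _ _ _ _ _ hX => hs X ((h.isCappellShanesonSphereOf_iff X hΔ).1 hX)⟩

/-- Everything Gompf equivalent to `A₀` is `Std`, granted the leaves (Kim–Yamada Remark 1.1, tree theorem). -/
theorem std_of_gompfEquiv_akbulutKirbyMatrix (hL : GompfLeaves) {A : SL(3, ℤ)} (h : GompfEquiv A akbulutKirbyMatrix) :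
    Std A :=
  fun X _ _ _ _ _ _ hX => nonempty_diffeomorph_sphere_four_of_gompfEquiv_akbulutKirbyMatrix X hL.1 hL.2.1 hL.2.2 h hX

/-- The decided rows: `det (A − 1) = 1` and trace in Kim–Yamada's window or Iwaki's eight extra traces ⟹ `Std A` (mod leaves). -/
theorem std_of_decided (hL : GompfLeaves) {A : SL(3, ℤ)} (hdet : ((A : Matrix (Fin 3) (Fin 3) ℤ) - 1).det = 1) {t : ℤ}
    (htr : Matrix.trace (A : Matrix (Fin 3) (Fin 3) ℤ) = t)
    (ht : (-64 ≤ t ∧ t ≤ 69) ∨ t = -73 ∨ t = -69 ∨ t = -67 ∨ t = -66 ∨ t = 71 ∨ t = 72 ∨ t = 74 ∨ t = 78) : Std A :=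
  fun X _ _ _ _ _ _ hX =>
    nonempty_diffeomorph_sphere_four_of_gompfConjectureForTrace X hL.1 hL.2.1 hL.2.2 (iwaki2025_thm_5_1 t ht) hdet htr hX

/-- Change of the numerals presenting one standard matrix. -/
theorem std_standardCSMatrix_congr {c d n c' d' n' : ℤ} (h : d ∣ (csPoly n).eval c) (h' : d' ∣ (csPoly n').eval c')
    (hc : c = c') (hd : d = d') (hn : n = n') : Std (standardCSMatrix c d n h) ↔ Std (standardCSMatrix c' d' n' h') := by
  subst hc hd hn; exact Iff.rfl

/-! ### transpose -/

theorem transpose_transpose (A : SL(3, ℤ)) : transpose (transpose A) = A :=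
  Subtype.ext (Matrix.transpose_transpose _)

/-- Conjugate matrices have conjugate transposes (in `SL(3,ℤ)`). -/
theorem isConj_transpose {A B : SL(3, ℤ)} (h : IsConj A B) : IsConj (transpose A) (transpose B) := by
  obtain ⟨P, hP, hPA⟩ := (isConj_iff_exists_isUnit_det A B).1 h
  refine ((isConj_iff_exists_isUnit_det _ _).2 ⟨P.transpose, by rwa [Matrix.det_transpose], ?_⟩).symm
  rw [Matrix.SpecialLinearGroup.coe_transpose, Matrix.SpecialLinearGroup.coe_transpose, ← Matrix.transpose_mul,
    ← Matrix.transpose_mul, hPA]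

theorem det_transpose_sub_one (A : SL(3, ℤ)) :
    ((transpose A : Matrix (Fin 3) (Fin 3) ℤ) - 1).det = ((A : Matrix (Fin 3) (Fin 3) ℤ) - 1).det := by
  rw [Matrix.SpecialLinearGroup.coe_transpose,
    show (A : Matrix (Fin 3) (Fin 3) ℤ).transpose - 1 = ((A : Matrix (Fin 3) (Fin 3) ℤ) - 1).transpose by
      rw [Matrix.transpose_sub, Matrix.transpose_one],
    Matrix.det_transpose]

/-- The Kim–Yamada dual commutes with transposition (both are polynomial in `A`). -/
theorem csDual_transpose {A : SL(3, ℤ)} (hA : ((A : Matrix (Fin 3) (Fin 3) ℤ) - 1).det = 1) :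
    csDual (transpose A) = transpose (csDual A) := by
  have hAT : ((transpose A : Matrix (Fin 3) (Fin 3) ℤ) - 1).det = 1 := by rw [det_transpose_sub_one]; exact hA
  apply Subtype.ext
  rw [coe_csDual hAT, Matrix.SpecialLinearGroup.coe_transpose, Matrix.SpecialLinearGroup.coe_transpose, coe_csDual hA]
  simp only [csDualMatrix, Matrix.transpose_add, Matrix.transpose_mul, Matrix.transpose_smul, Matrix.transpose_one,
    Matrix.trace_transpose]

/-! ### inverse -/

private def e2 (M : Matrix (Fin 3) (Fin 3) ℤ) : ℤ :=
  M 0 0 * M 1 1 - M 0 1 * M 1 0 + (M 0 0 * M 2 2 - M 0 2 * M 2 0) + (M 1 1 * M 2 2 - M 1 2 * M 2 1)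

private theorem trace_adjugate_eq (M : Matrix (Fin 3) (Fin 3) ℤ) : M.adjugate.trace = e2 M := by
  rw [Matrix.adjugate_fin_three, Matrix.trace_fin_three]
  simp [e2]
  ring

private theorem det_sub_one_expand (M : Matrix (Fin 3) (Fin 3) ℤ) : (M - 1).det = M.det - e2 M + M.trace - 1 := by
  simp [Matrix.det_fin_three, Matrix.trace_fin_three, e2]
  ring

/-- `tr A⁻¹ = tr A − det (A − 1)` in `SL(3,ℤ)` (`tr A⁻¹ = e₂(A)`, `det (A − 1) = e₁ − e₂`); so `det (A − 1) = −1 ⟹ tr A⁻¹ = tr A + 1`. -/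
theorem trace_inv (A : SL(3, ℤ)) :
    Matrix.trace ((A⁻¹ : SL(3, ℤ)) : Matrix (Fin 3) (Fin 3) ℤ) =
      Matrix.trace (A : Matrix (Fin 3) (Fin 3) ℤ) - ((A : Matrix (Fin 3) (Fin 3) ℤ) - 1).det := by
  rw [Matrix.SpecialLinearGroup.coe_inv, trace_adjugate_eq, det_sub_one_expand, Matrix.SpecialLinearGroup.det_coe]
  ring

/-- `det (A⁻¹ − 1) = − det (A − 1)` in `SL(3,ℤ)` (`A⁻¹ − 1 = A⁻¹ (1 − A)`, odd dimension). -/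
theorem det_inv_sub_one (A : SL(3, ℤ)) :
    (((A⁻¹ : SL(3, ℤ)) : Matrix (Fin 3) (Fin 3) ℤ) - 1).det = -(((A : Matrix (Fin 3) (Fin 3) ℤ)) - 1).det := by
  have hmul : ((A⁻¹ : SL(3, ℤ)) : Matrix (Fin 3) (Fin 3) ℤ) * (A : Matrix (Fin 3) (Fin 3) ℤ) = 1 := by
    rw [← Matrix.SpecialLinearGroup.coe_mul, inv_mul_cancel, Matrix.SpecialLinearGroup.coe_one]
  have h : ((A⁻¹ : SL(3, ℤ)) : Matrix (Fin 3) (Fin 3) ℤ) - 1 =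
      ((A⁻¹ : SL(3, ℤ)) : Matrix (Fin 3) (Fin 3) ℤ) * (-((A : Matrix (Fin 3) (Fin 3) ℤ) - 1)) := by
    rw [neg_sub, Matrix.mul_sub, Matrix.mul_one, hmul]
  rw [h, Matrix.det_mul, Matrix.det_neg, Matrix.SpecialLinearGroup.det_coe]
  simp

theorem transpose_inv (A : SL(3, ℤ)) : transpose A⁻¹ = (transpose A)⁻¹ :=
  Subtype.ext (by simp [Matrix.SpecialLinearGroup.coe_transpose, Matrix.SpecialLinearGroup.coe_inv, Matrix.adjugate_transpose])

/-- `InvSpheres` carries `Std` from `A⁻¹` to `A`. -/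
theorem std_of_std_inv (hI : InvSpheres) {A : SL(3, ℤ)} (h : Std A⁻¹) : Std A :=
  fun X _ _ _ _ _ _ hX => h X (hI A X hX)

/-! ## §4 The eight presentation certificates (PROVED; 7 re-keyed from the tree tables, 1 NEW) -/

theorem coe_M70a : (M70a : Matrix (Fin 3) (Fin 3) ℤ) = !![0, -2659, -3605; 0, 104, 141; 1, 0, -34] := by
  rw [M70a, coe_standardCSMatrix]; norm_num [csEntryA, eval_csPoly]
theorem coe_M70b : (M70b : Matrix (Fin 3) (Fin 3) ℤ) = !![0, 275, 1152; 0, 37, 155; 1, 0, 33] := by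
  rw [M70b, coe_standardCSMatrix]; norm_num [csEntryA, eval_csPoly]
theorem coe_M73a : (M73a : Matrix (Fin 3) (Fin 3) ℤ) = !![0, 171, 1078; 0, 23, 145; 1, 0, 50] := by
  rw [M73a, coe_standardCSMatrix]; norm_num [csEntryA, eval_csPoly]
theorem coe_M73c : (M73c : Matrix (Fin 3) (Fin 3) ℤ) = !![0, 269, 1240; 0, 41, 189; 1, 0, 32] := by
  rw [M73c, coe_standardCSMatrix]; norm_num [csEntryA, eval_csPoly]
theorem coe_M75a : (M75a : Matrix (Fin 3) (Fin 3) ℤ) = !![0, -1673, -2700; 0, 101, 163; 1, 0, -26] := by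
  rw [M75a, coe_standardCSMatrix]; norm_num [csEntryA, eval_csPoly]
theorem coe_B65 : (B65 : Matrix (Fin 3) (Fin 3) ℤ) = !![0, -17219, -20930; 0, 116, 141; 1, 0, -181] := by
  rw [B65, coe_standardCSMatrix]; norm_num [csEntryA, eval_csPoly]
theorem coe_B68 : (B68 : Matrix (Fin 3) (Fin 3) ℤ) = !![0, -797, -3399; 0, 34, 145; 1, 0, -102] := by
  rw [B68, coe_standardCSMatrix]; norm_num [csEntryA, eval_csPoly]
theorem coe_B70 : (B70 : Matrix (Fin 3) (Fin 3) ℤ) = !![0, -16733, -22729; 0, 120, 163; 1, 0, -190] := by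
  rw [B70, coe_standardCSMatrix]; norm_num [csEntryA, eval_csPoly]

/-- Host of `70a` (tree `rowI3_104_141_70`): `t = 70`, `b = (3,79,5)`, `c_b = (−426,17,−13)`, `k = 1`, landing trace `1`. -/
def H70a : SL(3, ℤ) := ⟨!![4986, 128639, 4705; -195, -5031, -184; 49, 1264, 46], by simp [Matrix.det_fin_three]⟩
/-- Host of `70b` (tree `rowI3_37_155_70`): `b = (2,−7,34)`, `c_b = (−31,−4,1)`, `k = −1`, landing `−53`. -/
def H70b : SL(3, ℤ) := ⟨!![-104, 639, -616; -14, 86, -83; -3, 14, -35], by simp [Matrix.det_fin_three]⟩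
/-- Host of `73a` (tree `row_23_145_73`): `b = (2,−15,5)`, `c_b = (135,17,−3)`, `k = 1`, landing `4`. -/
def H73a : SL(3, ℤ) := ⟨!![-654, 5076, -557; -88, 683, -75; -29, 225, -25], by simp [Matrix.det_fin_three]⟩
/-- Host of `73c` (tree `rowI3_41_189_73`): `b = (1,−3,18)`, `c_b = (−222,−32,7)`, `k = −1`, landing `−2`. -/
def H73c : SL(3, ℤ) := ⟨!![-72, 485, -56; -11, 74, -9; -1, 6, -4], by simp [Matrix.det_fin_three]⟩
/-- Host of `75a` (tree `row_101_163_75`): `b = (1,18,3)`, `c_b = (306,−19,12)`, `k = −2`, landing `5`; INDEX FIVE. -/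
def H75a : SL(3, ℤ) := ⟨!![1226, 20395, 978; -74, -1231, -59; 13, 216, 10], by simp [Matrix.det_fin_three]⟩
/-- Host of `X_{116,141,−65}` (tree `rowI3_116_141_neg65`): `b = (3,292,−188)`, `c_b = (−2532,17,−14)`, `k = −1`, landing `4`. -/
def H65 : SL(3, ℤ) := ⟨!![-891, -103943, 34906; 6, 700, -235; -5, -584, 195], by simp [Matrix.det_fin_three]⟩
/-- Host of `X_{34,145,−68}` (tree `rowI3_34_145_neg68`): `b = (3,73,5)`, `c_b = (−454,19,−5)`, `k = 1`, landing `1`. -/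
def H68 : SL(3, ℤ) := ⟨!![5556, 134399, 5861; -237, -5733, -250; 169, 4088, 178], by simp [Matrix.det_fin_three]⟩
/-- NEW host of `X_{120,163,−70} ∼ 75a*` (lens-5 g12, `compute/presentations.py`): `b = (−283,−39455,6)`, `c_b = (−868583,6229,−7299)`,
`k = 2`, landing trace `0`; INDEX FIVE. -/
def H70 : SL(3, ℤ) :=
  ⟨!![-34904718524, -4866309802473, 740006639; 250317462, 34898499990, -5306921; -293316481, -40893292570, 6218534],
    by simp [Matrix.det_fin_three]⟩

theorem pres_M70a : IsTwistPresentation 3 M70a H70a := by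
  refine ⟨1, ![3, 79, 5], ![-426, 17, -13], ![477, -19, 14], ![176, -7, 5], ![-26, 1, 0], -1, 3,
    by decide, ?_, by decide, by decide, Or.inl ?_, by decide, Or.inl (by norm_num), Or.inl (by decide)⟩
  · rw [coe_M70a]; decide
  · simp [Matrix.det_fin_three]

theorem pres_M70b : IsTwistPresentation 3 M70b H70b := by
  refine ⟨-1, ![2, -7, 34], ![-31, -4, 1], ![-641, -86, 20], ![-417, -56, 13], ![-3, -1, 0], -1, 3,
    by decide, ?_, by decide, by decide, Or.inl ?_, by decide, Or.inl (by norm_num), Or.inr (by decide)⟩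
  · rw [coe_M70b]; decide
  · simp [Matrix.det_fin_three]

theorem pres_M73a : IsTwistPresentation 3 M73a H73a := by
  refine ⟨1, ![2, -15, 5], ![135, 17, -3], ![-150, -19, 3], ![-55, -7, 1], ![-7, -1, 0], -1, 3,
    by decide, ?_, by decide, by decide, Or.inl ?_, by decide, Or.inl (by norm_num), Or.inl (by decide)⟩
  · rw [coe_M73a]; decide
  · simp [Matrix.det_fin_three]

theorem pres_M73c : IsTwistPresentation 3 M73c H73c := by
  refine ⟨-1, ![1, -3, 18], ![-222, -32, 7], ![-255, -37, 8], ![-96, -14, 3], ![1, 0, 0], -1, 3,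
    by decide, ?_, by decide, by decide, Or.inl ?_, by decide, Or.inl (by norm_num), Or.inr (by decide)⟩
  · rw [coe_M73c]; decide
  · simp [Matrix.det_fin_three]

theorem pres_M75a : IsTwistPresentation 5 M75a H75a := by
  refine ⟨-2, ![1, 18, 3], ![306, -19, 12], ![339, -21, 13], ![210, -13, 8], ![1, 0, 0], -3, 5,
    by decide, ?_, by decide, by decide, Or.inl ?_, by decide, Or.inl (by norm_num), Or.inr (by decide)⟩
  · rw [coe_M75a]; decide
  · simp [Matrix.det_fin_three]

theorem pres_B65 : IsTwistPresentation 3 B65 H65 := by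
  refine ⟨-1, ![3, 292, -188], ![-2532, 17, -14], ![12180, -82, 67], ![7276, -49, 40], ![-97, 1, 0], -1, 3,
    by decide, ?_, by decide, by decide, Or.inl ?_, by decide, Or.inl (by norm_num), Or.inl (by decide)⟩
  · rw [coe_B65]; decide
  · simp [Matrix.det_fin_three]

theorem pres_B68 : IsTwistPresentation 3 B68 H68 := by
  refine ⟨1, ![3, 73, 5], ![-454, 19, -5], ![-407, 17, -4], ![-120, 5, -1], ![-24, 1, 0], -1, 3,
    by decide, ?_, by decide, by decide, Or.inl ?_, by decide, Or.inl (by norm_num), Or.inr (by decide)⟩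
  · rw [coe_B68]; decide
  · simp [Matrix.det_fin_three]

/-- NEW certificate (index 5, landing 0) for the dual class `75a* ∼ X_{120,163,−70}`. -/
theorem pres_B70 : IsTwistPresentation 5 B70 H70 := by
  refine ⟨2, ![-283, -39455, 6], ![-868583, 6229, -7299], ![-11992, 86, -101], ![164123, -1177, 1379], ![1673, -12, 0], -3, 5,
    by decide, ?_, by decide, by decide, Or.inl ?_, by decide, Or.inl (by norm_num), Or.inr (by decide)⟩
  · rw [coe_B70]; decide
  · simp [Matrix.det_fin_three]

/-! ### the hosts are decided (landing traces `1, −53, 4, −2, 5, 4, 1, 0 ∈ [−64, 69]`) -/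

theorem std_H70a (hL : GompfLeaves) : Std H70a :=
  std_of_decided hL (t := 1) (by simp [H70a, Matrix.det_fin_three]) (by simp [H70a, Matrix.trace, Fin.sum_univ_three]) (by omega)
theorem std_H70b (hL : GompfLeaves) : Std H70b :=
  std_of_decided hL (t := -53) (by simp [H70b, Matrix.det_fin_three]) (by simp [H70b, Matrix.trace, Fin.sum_univ_three]) (by omega)
theorem std_H73a (hL : GompfLeaves) : Std H73a :=
  std_of_decided hL (t := 4) (by simp [H73a, Matrix.det_fin_three]) (by simp [H73a, Matrix.trace, Fin.sum_univ_three]) (by omega)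
theorem std_H73c (hL : GompfLeaves) : Std H73c :=
  std_of_decided hL (t := -2) (by simp [H73c, Matrix.det_fin_three]) (by simp [H73c, Matrix.trace, Fin.sum_univ_three]) (by omega)
theorem std_H75a (hL : GompfLeaves) : Std H75a :=
  std_of_decided hL (t := 5) (by simp [H75a, Matrix.det_fin_three]) (by simp [H75a, Matrix.trace, Fin.sum_univ_three]) (by omega)
theorem std_H65 (hL : GompfLeaves) : Std H65 :=
  std_of_decided hL (t := 4) (by simp [H65, Matrix.det_fin_three]) (by simp [H65, Matrix.trace, Fin.sum_univ_three]) (by omega)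
theorem std_H68 (hL : GompfLeaves) : Std H68 :=
  std_of_decided hL (t := 1) (by simp [H68, Matrix.det_fin_three]) (by simp [H68, Matrix.trace, Fin.sum_univ_three]) (by omega)
theorem std_H70 (hL : GompfLeaves) : Std H70 :=
  std_of_decided hL (t := 0) (by simp [H70, Matrix.det_fin_three]) (by simp [H70, Matrix.trace, Fin.sum_univ_three]) (by omega)

/-! ## §5 Routing the open classes (PROVED mod the stubs, passed as hypotheses) -/

section Routing

variable (hL : GompfLeaves) (h3 : TwistStd 3) (h5 : TwistStd 5)
include hL

/-! ### 5a. transpose intertwiners `X ∼ Yᵀ` (unimodular `W` with `W X = Yᵀ W`, checked entrywise) and `X_{83,105,73} ∼G A₀` -/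

omit hL in
theorem isConj_M70b_transpose_M70a : IsConj M70b (transpose M70a) :=
  (isConj_iff_exists_isUnit_det _ _).2
    ⟨!![-4, -37, -287; -312, -2749, -21812; -287, -2469, -19814], Int.isUnit_iff.mpr (by simp [Matrix.det_fin_three]), by
      simp only [M70a, M70b, Matrix.SpecialLinearGroup.coe_transpose, coe_standardCSMatrix, csEntryA, eval_csPoly]
      ext i j
      fin_cases i <;> fin_cases j <;> simp [Matrix.mul_apply, Fin.sum_univ_three]⟩

omit hL in
theorem isConj_M73b_transpose_M73a : IsConj M73b (transpose M73a) :=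
  (isConj_iff_exists_isUnit_det _ _).2
    ⟨!![0, 0, 1; 0, 1, 0; 1, 0, 50], Int.isUnit_iff.mpr (by simp [Matrix.det_fin_three]), by
      simp only [M73a, M73b, Matrix.SpecialLinearGroup.coe_transpose, coe_standardCSMatrix, csEntryA, eval_csPoly]
      ext i j
      fin_cases i <;> fin_cases j <;> simp [Matrix.mul_apply, Fin.sum_univ_three]⟩

omit hL in
theorem isConj_M75a_transpose_M75b : IsConj M75a (transpose M75b) :=
  (isConj_iff_exists_isUnit_det _ _).2
    ⟨!![13, 808, 966; 62, 3825, 4561; 966, 59859, 71488], Int.isUnit_iff.mpr (by simp [Matrix.det_fin_three]), by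
      simp only [M75a, M75b, Matrix.SpecialLinearGroup.coe_transpose, coe_standardCSMatrix, csEntryA, eval_csPoly]
      ext i j
      fin_cases i <;> fin_cases j <;> simp [Matrix.mul_apply, Fin.sum_univ_three]⟩

omit hL in
theorem isConj_M76b_transpose_M76a : IsConj M76b (transpose M76a) :=
  (isConj_iff_exists_isUnit_det _ _).2
    ⟨!![-11, -1044, -829; -686, -64951, -51509; -829, -78435, -62179], Int.isUnit_iff.mpr (by simp [Matrix.det_fin_three]), by
      simp only [M76a, M76b, Matrix.SpecialLinearGroup.coe_transpose, coe_standardCSMatrix, csEntryA, eval_csPoly]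
      ext i j
      fin_cases i <;> fin_cases j <;> simp [Matrix.mul_apply, Fin.sum_univ_three]⟩

omit hL in
theorem isConj_M77b_transpose_M77a : IsConj M77b (transpose M77a) :=
  (isConj_iff_exists_isUnit_det _ _).2
    ⟨!![4, 34, 317; 61, 461, 4589; 317, 2456, 24105], Int.isUnit_iff.mpr (by simp [Matrix.det_fin_three]), by
      simp only [M77a, M77b, Matrix.SpecialLinearGroup.coe_transpose, coe_standardCSMatrix, csEntryA, eval_csPoly]
      ext i j
      fin_cases i <;> fin_cases j <;> simp [Matrix.mul_apply, Fin.sum_univ_three]⟩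

omit hL in
theorem isConj_M83_transpose_M73c : IsConj M83 (transpose M73c) :=
  (isConj_iff_exists_isUnit_det _ _).2
    ⟨!![2, 132, 147; 18, 1151, 1276; 147, 9530, 10586], Int.isUnit_iff.mpr (by simp [Matrix.det_fin_three]), by
      simp only [M73c, M83, Matrix.SpecialLinearGroup.coe_transpose, coe_standardCSMatrix, csEntryA, eval_csPoly]
      ext i j
      fin_cases i <;> fin_cases j <;> simp [Matrix.mul_apply, Fin.sum_univ_three]⟩

omit hL in
/-- `X_{83,105,73} ∼G A₀` (one trace move to `−32`, inside Kim–Yamada's window): a tree theorem. -/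
theorem gompfEquiv_M83_akbulutKirbyMatrix : GompfEquiv M83 akbulutKirbyMatrix :=
  gompfEquiv_standardCSMatrix_akbulutKirbyMatrix_of_modEq (n₀ := -32)
    (gompfConjectureForTrace_of_mem_Icc_neg_sixtyfour_sixtynine (by norm_num)) dvd83 (Int.modEq_iff_dvd.2 (by norm_num))

omit hL in
/-- transposed forms of the intertwiners: `73bᵀ ∼ 73a`, `70bᵀ ∼ 70a` -/
theorem isConj_transpose_M73b_M73a : IsConj (transpose M73b) M73a := by
  simpa only [transpose_transpose] using isConj_transpose isConj_M73b_transpose_M73a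

omit hL in
theorem isConj_transpose_M70b_M70a : IsConj (transpose M70b) M70a := by
  simpa only [transpose_transpose] using isConj_transpose isConj_M70b_transpose_M70a

/-! ### 5b. the certified classes: `Std` from `TwistStd 3 / 5` -/

include h3 in
theorem std_M70a : Std M70a := h3 _ _ pres_M70a (std_H70a hL)
include h3 in
theorem std_M70b : Std M70b := h3 _ _ pres_M70b (std_H70b hL)
include h3 in
theorem std_M73a : Std M73a := h3 _ _ pres_M73a (std_H73a hL)
include h3 in
theorem std_M73c : Std M73c := h3 _ _ pres_M73c (std_H73c hL)
include h5 in
theorem std_M75a : Std M75a := h5 _ _ pres_M75a (std_H75a hL)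
include h3 in
theorem std_B65 : Std B65 := h3 _ _ pres_B65 (std_H65 hL)
include h3 in
theorem std_B68 : Std B68 := h3 _ _ pres_B68 (std_H68 hL)
include h5 in
theorem std_B70 : Std B70 := h5 _ _ pres_B70 (std_H70 hL)

/-! ### 5c. derived classes -/

include h3 in
/-- `76b = X_{116,141,76} ∼G X_{116,141,−65}` (one trace move). -/
theorem std_M76b : Std M76b := by
  have e := gompfEquiv_standardCSMatrix_add_mul dvd76b (-1)
  exact (std_congr_gompfEquiv hL.1 e).2 ((std_standardCSMatrix_congr _ dvdB65 rfl rfl (by norm_num)).2 (std_B65 hL h3))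

include h3 in
/-- `77b = X_{34,145,77} ∼G X_{34,145,−68}`. -/
theorem std_M77b : Std M77b := by
  have e := gompfEquiv_standardCSMatrix_add_mul dvd77b (-1)
  exact (std_congr_gompfEquiv hL.1 e).2 ((std_standardCSMatrix_congr _ dvdB68 rfl rfl (by norm_num)).2 (std_B68 hL h3))

include h3 in
theorem std_transpose_M73b : Std (transpose M73b) := (std_congr_isConj isConj_transpose_M73b_M73a).2 (std_M73a hL h3)
include h5 in
theorem std_transpose_M75b : Std (transpose M75b) := (std_congr_isConj isConj_M75a_transpose_M75b).1 (std_M75a hL h5)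
include h3 in
theorem std_transpose_M76a : Std (transpose M76a) := (std_congr_isConj isConj_M76b_transpose_M76a).1 (std_M76b hL h3)
include h3 in
theorem std_transpose_M77a : Std (transpose M77a) := (std_congr_isConj isConj_M77b_transpose_M77a).1 (std_M77b hL h3)

/-! ### 5d. duals of the named classes (Kim–Yamada Thm 3.3 explicit + Rem. 2.15 + one trace move) -/

include h3 in
/-- `70a* ∼ X_{3641,141,−65} ∼ X_{116,141,−65}`. -/
theorem std_csDual_M70a : Std (csDual M70a) := by
  have h1 := isConj_csDual_standardCSMatrix dvd70a
  have h2 := isConj_standardCSMatrix_cShift (dvd_eval_csPoly_dual dvd70a) (-25)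
  refine (std_congr_isConj h1).2 ((std_congr_isConj h2).2 ?_)
  exact (std_standardCSMatrix_congr _ dvdB65 (by norm_num) rfl (by norm_num)).2 (std_B65 hL h3)

include h3 in
/-- `73a* ∼ X_{−1126,145,−68} ∼ X_{34,145,−68}`. -/
theorem std_csDual_M73a : Std (csDual M73a) := by
  have h1 := isConj_csDual_standardCSMatrix dvd73a
  have h2 := isConj_standardCSMatrix_cShift (dvd_eval_csPoly_dual dvd73a) 8
  refine (std_congr_isConj h1).2 ((std_congr_isConj h2).2 ?_)
  exact (std_standardCSMatrix_congr _ dvdB68 (by norm_num) rfl (by norm_num)).2 (std_B68 hL h3)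

include h5 in
/-- `75a* ∼ X_{2728,163,−70} ∼ X_{120,163,−70}` (NEW certificate, index five). -/
theorem std_csDual_M75a : Std (csDual M75a) := by
  have h1 := isConj_csDual_standardCSMatrix dvd75a
  have h2 := isConj_standardCSMatrix_cShift (dvd_eval_csPoly_dual dvd75a) (-16)
  refine (std_congr_isConj h1).2 ((std_congr_isConj h2).2 ?_)
  exact (std_standardCSMatrix_congr _ dvdB70 (by norm_num) rfl (by norm_num)).2 (std_B70 hL h5)

include h3 in
/-- `76b* ∼ X_{4757,141,−71} ∼ X_{104,141,−71} ∼G X_{104,141,70} = 70a`. -/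
theorem std_csDual_M76b : Std (csDual M76b) := by
  have h1 := isConj_csDual_standardCSMatrix dvd76b
  have h2 := isConj_standardCSMatrix_cShift (dvd_eval_csPoly_dual dvd76b) (-33)
  have h3' := gompfEquiv_standardCSMatrix_add_mul (dvd_eval_csPoly_cShift (dvd_eval_csPoly_dual dvd76b) (-33)) 1
  refine (std_congr_isConj h1).2 ((std_congr_isConj h2).2 ((std_congr_gompfEquiv hL.1 h3').2 ?_))
  exact (std_standardCSMatrix_congr _ dvd70a (by norm_num) rfl (by norm_num)).2 (std_M70a hL h3)

include h3 in
/-- `77b* ∼ X_{−1427,145,−72} ∼ X_{23,145,−72} ∼G X_{23,145,73} = 73a`. -/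
theorem std_csDual_M77b : Std (csDual M77b) := by
  have h1 := isConj_csDual_standardCSMatrix dvd77b
  have h2 := isConj_standardCSMatrix_cShift (dvd_eval_csPoly_dual dvd77b) 10
  have h3' := gompfEquiv_standardCSMatrix_add_mul (dvd_eval_csPoly_cShift (dvd_eval_csPoly_dual dvd77b) 10) 1
  refine (std_congr_isConj h1).2 ((std_congr_isConj h2).2 ((std_congr_gompfEquiv hL.1 h3').2 ?_))
  exact (std_standardCSMatrix_congr _ dvd73a (by norm_num) rfl (by norm_num)).2 (std_M73a hL h3)

/-- `X_{83,105,73}* ∼G A₀* ∼G A₀`: decided. -/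
theorem std_csDual_M83 : Std (csDual M83) :=
  std_of_gompfEquiv_akbulutKirbyMatrix hL
    ((gompfEquiv_csDual gompfEquiv_M83_akbulutKirbyMatrix (det_standardCSMatrix_sub_one dvd83)).trans
      gompfEquiv_csDual_akbulutKirbyMatrix)

omit hL in
/-- Transport pattern for the negative traces routed through `ᵀ`: `A = B*`, `B ∼ M`, `Mᵀ ∼ M'`, `Std M'*` ⟹ `Std Aᵀ`
(`(B*)ᵀ = (Bᵀ)* ∼ (Mᵀ)* ∼ M'*`). -/
theorem std_transpose_csDual_of {B M M' : SL(3, ℤ)} (hB : ((B : Matrix (Fin 3) (Fin 3) ℤ) - 1).det = 1)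
    (h : IsConj B M) (hT : IsConj (transpose M) M') (hstd : Std (csDual M')) : Std (transpose (csDual B)) := by
  rw [← csDual_transpose hB]
  exact (std_congr_isConj ((isConj_csDual (isConj_transpose h)).trans (isConj_csDual hT))).2 hstd

end Routing

/-! ## §6 The composition (PROVED mod the stubs): `Std A ∨ Std Aᵀ` on the whole window, then the crux BY NAME -/

section Composition

variable (hL : GompfLeaves) (hC : WindowCover) (h3 : TwistStd 3) (h5 : TwistStd 5)
include hL hC h3 h5

/-- Positive open traces `70, 73, 75, 76, 77`. -/
theorem stdOrT_pos {A : SL(3, ℤ)} (hdet : ((A : Matrix (Fin 3) (Fin 3) ℤ) - 1).det = 1)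
    (htr : Matrix.trace (A : Matrix (Fin 3) (Fin 3) ℤ) = 70 ∨ Matrix.trace (A : Matrix (Fin 3) (Fin 3) ℤ) = 73 ∨
      Matrix.trace (A : Matrix (Fin 3) (Fin 3) ℤ) = 75 ∨ Matrix.trace (A : Matrix (Fin 3) (Fin 3) ℤ) = 76 ∨
      Matrix.trace (A : Matrix (Fin 3) (Fin 3) ℤ) = 77) :
    Std A ∨ Std (transpose A) := by
  rcases hC A hdet htr with hG | h | h | h | h | h | h | h | h | h | h | h
  · exact Or.inl (std_of_gompfEquiv_akbulutKirbyMatrix hL hG)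
  · exact Or.inl ((std_congr_isConj h).2 (std_M70a hL h3))
  · exact Or.inl ((std_congr_isConj h).2 (std_M70b hL h3))
  · exact Or.inl ((std_congr_isConj h).2 (std_M73a hL h3))
  · exact Or.inr ((std_congr_isConj (isConj_transpose h)).2 (std_transpose_M73b hL h3))
  · exact Or.inl ((std_congr_isConj h).2 (std_M73c hL h3))
  · exact Or.inl ((std_congr_isConj h).2 (std_M75a hL h5))
  · exact Or.inr ((std_congr_isConj (isConj_transpose h)).2 (std_transpose_M75b hL h5))
  · exact Or.inr ((std_congr_isConj (isConj_transpose h)).2 (std_transpose_M76a hL h3))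
  · exact Or.inl ((std_congr_isConj h).2 (std_M76b hL h3))
  · exact Or.inr ((std_congr_isConj (isConj_transpose h)).2 (std_transpose_M77a hL h3))
  · exact Or.inl ((std_congr_isConj h).2 (std_M77b hL h3))

/-- Negative open traces `−65, −68, −70, −71, −72`, through `A = (A*)*` and the cover of `A*`. -/
theorem stdOrT_neg {A : SL(3, ℤ)} (hdet : ((A : Matrix (Fin 3) (Fin 3) ℤ) - 1).det = 1)
    (htr : Matrix.trace (A : Matrix (Fin 3) (Fin 3) ℤ) = -65 ∨ Matrix.trace (A : Matrix (Fin 3) (Fin 3) ℤ) = -68 ∨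
      Matrix.trace (A : Matrix (Fin 3) (Fin 3) ℤ) = -70 ∨ Matrix.trace (A : Matrix (Fin 3) (Fin 3) ℤ) = -71 ∨
      Matrix.trace (A : Matrix (Fin 3) (Fin 3) ℤ) = -72) :
    Std A ∨ Std (transpose A) := by
  have hB : (((csDual A : SL(3, ℤ)) : Matrix (Fin 3) (Fin 3) ℤ) - 1).det = 1 := det_coe_csDual_sub_one hdet
  have htrB : Matrix.trace ((csDual A : SL(3, ℤ)) : Matrix (Fin 3) (Fin 3) ℤ) = 70 ∨
      Matrix.trace ((csDual A : SL(3, ℤ)) : Matrix (Fin 3) (Fin 3) ℤ) = 73 ∨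
      Matrix.trace ((csDual A : SL(3, ℤ)) : Matrix (Fin 3) (Fin 3) ℤ) = 75 ∨
      Matrix.trace ((csDual A : SL(3, ℤ)) : Matrix (Fin 3) (Fin 3) ℤ) = 76 ∨
      Matrix.trace ((csDual A : SL(3, ℤ)) : Matrix (Fin 3) (Fin 3) ℤ) = 77 := by
    rw [trace_coe_csDual hdet]; omega
  have hA : A = csDual (csDual A) := (csDual_csDual hdet).symm
  rcases hC (csDual A) hB htrB with hG | h | h | h | h | h | h | h | h | h | h | h
  · left; rw [hA]
    exact std_of_gompfEquiv_akbulutKirbyMatrix hL ((gompfEquiv_csDual hG hB).trans gompfEquiv_csDual_akbulutKirbyMatrix)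
  · left; rw [hA]; exact (std_congr_isConj (isConj_csDual h)).2 (std_csDual_M70a hL h3)
  · right; rw [hA]
    exact std_transpose_csDual_of hB h isConj_transpose_M70b_M70a (std_csDual_M70a hL h3)
  · left; rw [hA]; exact (std_congr_isConj (isConj_csDual h)).2 (std_csDual_M73a hL h3)
  · right; rw [hA]
    exact std_transpose_csDual_of hB h isConj_transpose_M73b_M73a (std_csDual_M73a hL h3)
  · right; rw [hA]
    exact std_transpose_csDual_of hB h isConj_M83_transpose_M73c.symm (std_csDual_M83 hL)
  · left; rw [hA]; exact (std_congr_isConj (isConj_csDual h)).2 (std_csDual_M75a hL h5)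
  · right; rw [hA]
    exact std_transpose_csDual_of hB h isConj_M75a_transpose_M75b.symm (std_csDual_M75a hL h5)
  · right; rw [hA]
    exact std_transpose_csDual_of hB h isConj_M76b_transpose_M76a.symm (std_csDual_M76b hL h3)
  · left; rw [hA]; exact (std_congr_isConj (isConj_csDual h)).2 (std_csDual_M76b hL h3)
  · right; rw [hA]
    exact std_transpose_csDual_of hB h isConj_M77b_transpose_M77a.symm (std_csDual_M77b hL h3)
  · left; rw [hA]; exact (std_congr_isConj (isConj_csDual h)).2 (std_csDual_M77b hL h3)

/-- The `det (A − 1) = 1` half of the window. -/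
theorem stdOrT_det_one {A : SL(3, ℤ)} (hdet : ((A : Matrix (Fin 3) (Fin 3) ℤ) - 1).det = 1)
    (htr : Matrix.trace (A : Matrix (Fin 3) (Fin 3) ℤ) ∈ Icc (-73 : ℤ) 78) : Std A ∨ Std (transpose A) := by
  obtain ⟨h1, h2⟩ := mem_Icc.1 htr
  by_cases hpos : Matrix.trace (A : Matrix (Fin 3) (Fin 3) ℤ) = 70 ∨ Matrix.trace (A : Matrix (Fin 3) (Fin 3) ℤ) = 73 ∨
      Matrix.trace (A : Matrix (Fin 3) (Fin 3) ℤ) = 75 ∨ Matrix.trace (A : Matrix (Fin 3) (Fin 3) ℤ) = 76 ∨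
      Matrix.trace (A : Matrix (Fin 3) (Fin 3) ℤ) = 77
  · exact stdOrT_pos hL hC h3 h5 hdet hpos
  by_cases hneg : Matrix.trace (A : Matrix (Fin 3) (Fin 3) ℤ) = -65 ∨ Matrix.trace (A : Matrix (Fin 3) (Fin 3) ℤ) = -68 ∨
      Matrix.trace (A : Matrix (Fin 3) (Fin 3) ℤ) = -70 ∨ Matrix.trace (A : Matrix (Fin 3) (Fin 3) ℤ) = -71 ∨
      Matrix.trace (A : Matrix (Fin 3) (Fin 3) ℤ) = -72
  · exact stdOrT_neg hL hC h3 h5 hdet hneg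
  · have key : (-64 ≤ Matrix.trace (A : Matrix (Fin 3) (Fin 3) ℤ) ∧ Matrix.trace (A : Matrix (Fin 3) (Fin 3) ℤ) ≤ 69) ∨
        Matrix.trace (A : Matrix (Fin 3) (Fin 3) ℤ) = -73 ∨ Matrix.trace (A : Matrix (Fin 3) (Fin 3) ℤ) = -69 ∨
        Matrix.trace (A : Matrix (Fin 3) (Fin 3) ℤ) = -67 ∨ Matrix.trace (A : Matrix (Fin 3) (Fin 3) ℤ) = -66 ∨
        Matrix.trace (A : Matrix (Fin 3) (Fin 3) ℤ) = 71 ∨ Matrix.trace (A : Matrix (Fin 3) (Fin 3) ℤ) = 72 ∨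
        Matrix.trace (A : Matrix (Fin 3) (Fin 3) ℤ) = 74 ∨ Matrix.trace (A : Matrix (Fin 3) (Fin 3) ℤ) = 78 := by
      omega
    exact Or.inl (std_of_decided hL hdet rfl key)

/-- The `det (A − 1) = −1` half: pass to `A⁻¹` (`det = 1`, trace `tr A + 1`) and pull back with `InvSpheres`. -/
theorem stdOrT_det_neg_one (hI : InvSpheres) {A : SL(3, ℤ)} (hdet : ((A : Matrix (Fin 3) (Fin 3) ℤ) - 1).det = -1)
    (htr : Matrix.trace (A : Matrix (Fin 3) (Fin 3) ℤ) ∈ Icc (-74 : ℤ) 77) : Std A ∨ Std (transpose A) := by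
  have hdet' : (((A⁻¹ : SL(3, ℤ)) : Matrix (Fin 3) (Fin 3) ℤ) - 1).det = 1 := by rw [det_inv_sub_one, hdet]; norm_num
  have htr' : Matrix.trace ((A⁻¹ : SL(3, ℤ)) : Matrix (Fin 3) (Fin 3) ℤ) ∈ Icc (-73 : ℤ) 78 := by
    obtain ⟨h1, h2⟩ := mem_Icc.1 htr
    rw [trace_inv, hdet]
    exact mem_Icc.2 ⟨by omega, by omega⟩
  rcases stdOrT_det_one hL hC h3 h5 hdet' htr' with h | h
  · exact Or.inl (std_of_std_inv hI h)
  · refine Or.inr (std_of_std_inv hI ?_)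
    rwa [← transpose_inv]

/-- **S⁴ is in the ⟨ᵀ⟩-orbit of every window class** (the transposition form; STRONGER than the crux, which also allows the dual). -/
theorem windowStdOrTranspose (hI : InvSpheres) (A : SL(3, ℤ))
    (hA : (((A : Matrix (Fin 3) (Fin 3) ℤ) - 1).det = 1 ∧ Matrix.trace (A : Matrix (Fin 3) (Fin 3) ℤ) ∈ Icc (-73 : ℤ) 78) ∨
      (((A : Matrix (Fin 3) (Fin 3) ℤ) - 1).det = -1 ∧ Matrix.trace (A : Matrix (Fin 3) (Fin 3) ℤ) ∈ Icc (-74 : ℤ) 77)) :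
    Std A ∨ Std (transpose A) := by
  rcases hA with ⟨hdet, htr⟩ | ⟨hdet, htr⟩
  · exact stdOrT_det_one hL hC h3 h5 hdet htr
  · exact stdOrT_det_neg_one hL hC h3 h5 hI hdet htr

end Composition

/-- **`WindowOrbitStandard_of` — THE SKELETON** (writer W1 form: hypothesis-free; the five REGISTERED stubs are used by name):
`stub_gompfLeaves → stub_invSpheres → windowCover → stub_twistThree → stub_twistFive →` the crux
`RootDecompAD.WindowOrbitStandard` BY NAME (real proof, no sorry of its own). -/
theorem WindowOrbitStandard_of :
    Summit.SmoothPoincare4.SmoothPoincare4.Theses.RootDecompAD.WindowOrbitStandard := by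
  intro A hA
  rcases windowStdOrTranspose stub_gompfLeaves windowCover stub_twistThree stub_twistFive stub_invSpheres A hA with h | h
  · exact Or.inl h
  · exact Or.inr (Or.inl h)

#print axioms WindowOrbitStandard_of

/-! ## §7 Sanity: the binder form and what the line does NOT use -/

/-- Binder form (informational, SORRY-FREE): the crux from the five stub STATEMENTS as hypotheses — the kernel certificate that
`GompfLeaves ∧ InvSpheres ∧ SevenChains ∧ TwistStd 3 ∧ TwistStd 5 ⟹ WindowOrbitStandard` (floor: named facts, Gompf 2010 §3 ¶1, a tree theorem;
open: the two twist statements). -/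
example (hL : GompfLeaves) (hI : InvSpheres) (hS : SevenChains) (h3 : TwistStd 3) (h5 : TwistStd 5) :
    Summit.SmoothPoincare4.SmoothPoincare4.Theses.RootDecompAD.WindowOrbitStandard := by
  intro A hA
  rcases windowStdOrTranspose hL (windowCover_of hS) h3 h5 hI A hA with h | h
  · exact Or.inl h
  · exact Or.inr (Or.inl h)


end Summit.SmoothPoincare4.SmoothPoincare4.Cruxes.WindowOrbitStandard.TwistIndex
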